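import Literature.NumberTheory.LFunctions.MoebiusWalshGeomSums
import Literature.NumberTheory.LFunctions.MoebiusWalshLocalised
import HarnessLib

/-!
# Bourgain 2013, §2: the diophantine counting core of the type-II analysis, HIGH window — proved

Topic `Literature/NumberTheory/LFunctions`, a proofs companion of `MoebiusWalshCircuits.lean` (named
facts `bourgain_moebius_walsh_uniform`, `bourgain_liouville_walsh_uniform`: J. Bourgain,
*Möbius–Walsh correlation bounds and an estimate of Mauduit and Rivat*, J. Anal. Math. **119** (2013)
147–163 = arXiv:1109.2784 [Bourgain2013MoebiusWalsh], Theorem 1), sibling of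
`MoebiusWalshGeomSums.lean` (the majorant `geomBound V x = min(V, 1/(2‖x‖))` of
`Literature.NumberTheory.Sieve.Vinogradov` and its full-period / interval bounds along `ak/2^L`),
of `MoebiusWalshLocalised.lean` (Lemma 5: the Fourier-localised substitute `W_{S'}` whose
coefficients are the weights below) and of `MoebiusWalshTypeIICore.lean` (the same count for the
UNSHIFTED window `K = 0`, (2.13)–(2.22)). Everything here is PROVED (theorems only); no definition,
no named fact.

## What this file supplies

In the TYPE-II analysis of §2, after van der Corput differencing in `n` with lags `ℓ2^K`
((2.2), tree `MoebiusWalsh.vdC_bilinear`), carry truncation to the digit window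
`S' = S ∩ [K, K+μ+ρ']` (tree `MoebiusWalshTypeIITools`) and — for the SHIFTED windows
`μ - ρ ≤ K < λ - μ - ρ` of the paper ((2.23)) — the replacement of `w_{S'}` by its localised
substitute `W_{S'} = ∑_{|k| < F} Ŵ(k) e(-kx/2^{K+σ})`, `σ = μ + ρ'`, `F = 2K₁2^σ` ((2.3), (2.8);
tree `MoebiusWalsh.localisedWalsh`), the `m`-summation of (2.11) is a geometric sum and one is left
with the purely diophantine quantity

  `∑_n ∑_{k ≠ k'} c(k)c(k') min(M, 1/(2‖((k'-k)n + k'ℓ2^K)/2^{K+σ}‖))`,   `c = |Ŵ| ≥ 0`,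

which §2 of the paper ((2.23)–(2.28)) shows to be `≪ MNL ×` (a negative power of `L`, or `‖Ŵ‖_∞`),
with a smoothed `m`-sum and a three-way case analysis. This file proves that bound in the
mollifier-free form of `MoebiusWalshGeomSums` (sharp cutoffs, dyadic layers, logarithmic losses
accepted — every saving in the paper is a power of `2^{-λ^{1/10}}`) as ONE abstract inequality,
`typeII_count_high`, whose hypotheses on the weights `c` are exactly what §1 provides for `|Ŵ_{S'}|`
(`|Ŵ| ≤ |ŵ_{S'}(·/2^{K+σ})|`, tree `norm_localisedCoeff_le`): total mass `A₁` (Lemma 5 (1.11) /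
(2.10), tree `sum_norm_walshCoeff_le_of_forall_le`), sup `A_∞ = 2·2^{-c|S'|}` (Lemma 2 / (2.9), tree
`norm_walshCoeff_le_two_mul_rpow`) and `≤ B J^κ` on windows of `J` consecutive frequencies (Lemma 6,
tree `sum_Ico_norm_walshCoeff_le_rpow`, `κ = walshL1Exponent < 1/2`, `B = 4`, up to `J ≤ 4·2^{K+σ}`
by splitting into four windows).

* `sum_Ico_geomBound_linear_le` — `∑_{n<N} min(M, 1/(2‖αn + β‖)) ≤ (4αN + 1)(2M + α⁻¹(1 + log α⁻¹))`
  for a real slope `0 < α ≤ 1/2` (blocks of `⌊1/(2α)⌋` `α`-separated points and the tree's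
  well-spacing lemma `Vinogradov.sum_geomBound_le_of_separated`): the count "letting `n` range over
  an interval of size `ML2^K/Δk` …" of (2.24).
* `sum_Ico_geomBound_far_le` — on a short arc (`αn ≤ w`) away from the lattice (`‖β‖ ≥ 2w`) every
  phase is `≥ ‖β‖/2` from `ℤ`: the mechanism of (2.25)–(2.27).
* `sum_filter_distInt_lt_le` — frequencies `k` with `‖kℓ/2^σ‖ < η'` are covered by `≤ 2FL/2^σ + 3`
  windows of `≤ 2η'2^σ + 1` consecutive integers ("this restricts `k'` to at most `L²` intervals
  of size …", after (2.24)).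
* `geomBound_le_one_add_sum_layers`, `sum_mul_geomBound_le_layers` — dyadic layer-cake for the
  majorant (the substitute for the smooth cutoff `M₁`); `sum_Ioo_mul_geomBound_le_sup` — the sup
  route ((2.27)).
* `sum_Ico_geomBound_pair_high` — ONE PAIR: with `|k'-k| ∈ [2^d, 2^{d+1})`, either many turns
  (`Q ≤ 16N2^d`, (2.24)) or a short arc, near/far from the lattice `(2^σ/ℓ)ℤ` ((2.25)–(2.27)).
* `typeII_count_high` — the assembled bound `(K+σ)(T_A + T_{B1} + T_{B2})` with the three regimes
  of the paper made explicit (see its docstring); with `2^σ = ML^{1+ε}`, `M/L ≤ 2^K ≤ N/L`,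
  `F = 2^{t+1}2^σ`, `D₀ = L^C` every term is `≪ MNL · λ L^{O(C)}(M^{-(1-2κ)} + L^{-C(1-2κ)} + A_∞L^{O(C)})`,
  which is (2.28) for the shifted windows up to the harmless logarithm `λ = 1 + log 2^{K+σ}`.

The diagonal `k = k'` and the lag `ℓ = 0` ((2.13)–(2.14)) are not part of the statement (constant
phase in `n`; the consumer bounds them with `sum_Ioo_mul_geomBound_le_sup`).

## References

* J. Bourgain, *Möbius–Walsh correlation bounds and an estimate of Mauduit and Rivat*, J. Anal.
  Math. 119 (2013) 147–163; arXiv:1109.2784, §2, (2.11)–(2.12), (2.23)–(2.28). [Bourgain2013MoebiusWalsh]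
* C. Mauduit, J. Rivat, Ann. of Math. 171 (2010) 1591–1646, §§5–6 (the origin of the method).
  [cited through Bourgain]
-/

noncomputable section

open Finset Real

namespace Literature.NumberTheory.LFunctions.MoebiusWalsh

open Literature.NumberTheory.Sieve.Vinogradov (distInt geomBound distInt_nonneg distInt_add_int
  distInt_le_abs_sub_int distInt_le_half distInt_neg distInt_add_le geomBound_le geomBound_nonneg
  geomBound_neg geomBound_mono geomBound_le_inv distInt_eq_zero_iff sum_geomBound_le_of_separated)

/-! ### Distance to the nearest integer: three small facts -/

/-- On `[0, 1/2]` the distance to `ℤ` is the identity (private copy of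
`FejerCounting.distInt_eq_self`, kept local to avoid an extra import edge). [folklore] -/
private theorem distInt_eq_self_of_le_half {x : ℝ} (h0 : 0 ≤ x) (h1 : x ≤ 1 / 2) : distInt x = x := by
  refine le_antisymm ?_ ?_
  · have := distInt_le_abs_sub_int x 0
    rwa [Int.cast_zero, sub_zero, abs_of_nonneg h0] at this
  · unfold distInt
    rcases le_or_gt (round x : ℤ) 0 with hr | hr
    · have : ((round x : ℤ) : ℝ) ≤ 0 := by exact_mod_cast hr
      rw [abs_of_nonneg (by linarith)]; linarith
    · have : (1 : ℝ) ≤ ((round x : ℤ) : ℝ) := by exact_mod_cast hr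
      rw [abs_of_nonpos (by linarith)]; linarith

/-- `‖β‖ - |x| ≤ ‖β + x‖`. [folklore] -/
theorem distInt_sub_abs_le (β x : ℝ) : distInt β - |x| ≤ distInt (β + x) := by
  have h1 : distInt β ≤ distInt (β + x) + distInt (-x) := by
    have := distInt_add_le (β + x) (-x); rwa [add_neg_cancel_right] at this
  have h2 : distInt (-x) ≤ |x| := by
    have := distInt_le_abs_sub_int (-x) 0
    rwa [Int.cast_zero, sub_zero, abs_neg] at this
  linarith

/-- `min(V, 1/(2‖x + n‖)) = min(V, 1/(2‖x‖))` for an integer `n`. [folklore] -/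
private theorem geomBound_add_intCast (V x : ℝ) (n : ℤ) : geomBound V (x + n) = geomBound V x := by
  unfold geomBound; rw [distInt_add_int]

/-! ### Geometric-sum majorants along a real linear phase `αn + β` -/

/-- **One block of `α`-separated points.** If `0 < α ≤ 1/2` and `B = ⌊1/(2α)⌋`, then for every
`N₀`: `∑_{n ∈ [N₀, N₀+B)} min(M, 1/(2‖αn + β‖)) ≤ 2M + α⁻¹(1 + log α⁻¹)` — consecutive points of the
block are at mutual distances `α|n-n'| ≤ 1/2`, hence `α`-separated modulo `1`, and the tree's
well-spacing lemma applies. [folklore] -/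
theorem sum_block_geomBound_linear_le {α : ℝ} (hα0 : 0 < α) (hα : α ≤ 1 / 2) (β : ℝ) {M : ℝ}
    (hM : 0 ≤ M) (N₀ : ℕ) :
    ∑ n ∈ Ico N₀ (N₀ + ⌊1 / (2 * α)⌋₊), geomBound M (α * n + β) ≤
      2 * M + (1 / α) * (1 + Real.log (1 / α)) := by
  set B : ℕ := ⌊1 / (2 * α)⌋₊ with hB
  have hBle : (B : ℝ) ≤ 1 / (2 * α) := Nat.floor_le (by positivity)
  have hsep : ∀ i ∈ Ico N₀ (N₀ + B), ∀ j ∈ Ico N₀ (N₀ + B), i ≠ j →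
      α ≤ distInt ((α * i + β) - (α * j + β)) := by
    intro i hi j hj hij
    rw [Finset.mem_Ico] at hi hj
    wlog hlt : j < i generalizing i j
    · have h := this j hj i hi (Ne.symm hij) (lt_of_le_of_ne (not_lt.mp hlt) hij)
      rwa [← distInt_neg, neg_sub]
    have hd1 : (1 : ℝ) ≤ (i : ℝ) - j := by
      have : j + 1 ≤ i := hlt
      have : ((j + 1 : ℕ) : ℝ) ≤ i := by exact_mod_cast this
      push_cast at this; linarith
    have hd2 : ((i : ℝ) - j) ≤ B - 1 := by
      have : i ≤ j + (B - 1) := by omega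
      have h' : ((i : ℕ) : ℝ) ≤ ((j + (B - 1) : ℕ) : ℝ) := by exact_mod_cast this
      have hB1 : 1 ≤ B := by omega
      push_cast [Nat.cast_sub hB1] at h'
      linarith
    rw [show (α * i + β) - (α * j + β) = α * ((i : ℝ) - j) by ring]
    have hx0 : 0 ≤ α * ((i : ℝ) - j) := by positivity
    have hx1 : α * ((i : ℝ) - j) ≤ 1 / 2 := by
      calc α * ((i : ℝ) - j) ≤ α * (B - 1) := mul_le_mul_of_nonneg_left hd2 hα0.le
        _ ≤ α * (1 / (2 * α)) := mul_le_mul_of_nonneg_left (by linarith) hα0.le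
        _ = 1 / 2 := by field_simp
    rw [distInt_eq_self_of_le_half hx0 hx1]
    nlinarith
  have hm : 1 / (2 * α) ≤ ((B + 1 : ℕ) : ℝ) := by
    push_cast; rw [hB]; exact (Nat.lt_floor_add_one _).le
  have h := sum_geomBound_le_of_separated (Ico N₀ (N₀ + B)) (fun n : ℕ => α * n + β) hα0 hm hsep hM
  refine h.trans (add_le_add le_rfl (mul_le_mul_of_nonneg_left ?_ (by positivity)))
  have h1 : ((B + 1 : ℕ) : ℝ) ≤ 1 / α := by
    push_cast
    have : 1 / (2 * α) + 1 ≤ 1 / α := by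
      rw [div_add_one (by positivity), div_le_div_iff₀ (by positivity) hα0]; nlinarith
    linarith
  have h2 : (0 : ℝ) < ((B + 1 : ℕ) : ℝ) := by positivity
  linarith [Real.log_le_log h2 h1]

/-- **A linear phase over an interval** (the count behind Bourgain 2013, (2.24)): for
`0 < α ≤ 1/2`, every `β`, `M ≥ 0` and every interval of `N` consecutive integers,
`∑_n min(M, 1/(2‖αn + β‖)) ≤ (4αN + 1)(2M + α⁻¹(1 + log α⁻¹))` (cover the interval by `≤ 4αN + 1`
blocks of length `⌊1/(2α)⌋`). [cite: Bourgain2013MoebiusWalsh, §2 (2.24)] -/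
theorem sum_Ico_geomBound_linear_le {α : ℝ} (hα0 : 0 < α) (hα : α ≤ 1 / 2) (β : ℝ) {M : ℝ}
    (hM : 0 ≤ M) (N₀ N : ℕ) :
    ∑ n ∈ Ico N₀ (N₀ + N), geomBound M (α * n + β) ≤
      (4 * α * N + 1) * (2 * M + (1 / α) * (1 + Real.log (1 / α))) := by
  set B : ℕ := ⌊1 / (2 * α)⌋₊ with hB
  have hB1 : 1 ≤ B := by
    rw [hB, Nat.one_le_floor_iff]
    rw [le_div_iff₀ (by positivity)]; linarith
  have hBpos : 0 < B := hB1
  set T : ℕ := N / B + 1 with hT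
  set g : ℕ → ℝ := fun n => geomBound M (α * n + β) with hg
  have hg0 : ∀ n, 0 ≤ g n := fun n => geomBound_nonneg hM _
  have hX0 : 0 ≤ 2 * M + (1 / α) * (1 + Real.log (1 / α)) := by
    have : 0 ≤ Real.log (1 / α) := Real.log_nonneg (by rw [le_div_iff₀ hα0]; linarith)
    positivity
  -- cover by `T` blocks
  have hsub : Ico N₀ (N₀ + N) ⊆ Ico N₀ (N₀ + B * T) := by
    apply Finset.Ico_subset_Ico_right
    have : N < B * (N / B) + B := Nat.lt_mul_div_succ N hBpos
    rw [hT]; nlinarith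
  have hblocks : ∑ n ∈ Ico N₀ (N₀ + B * T), g n = ∑ u ∈ range T, ∑ k ∈ range B, g (N₀ + (k + B * u)) := by
    rw [Finset.sum_Ico_eq_sum_range, show N₀ + B * T - N₀ = B * T by omega, sum_range_mul_eq_sum_sum]
  have hblock : ∀ u : ℕ, ∑ k ∈ range B, g (N₀ + (k + B * u)) ≤ 2 * M + (1 / α) * (1 + Real.log (1 / α)) := by
    intro u
    have h := sum_block_geomBound_linear_le hα0 hα β hM (N₀ + B * u)
    rw [← hB, Finset.sum_Ico_eq_sum_range, show N₀ + B * u + B - (N₀ + B * u) = B by omega] at h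
    refine le_trans (le_of_eq (Finset.sum_congr rfl fun k _ => ?_)) h
    rw [show N₀ + (k + B * u) = N₀ + B * u + k by ring]
  calc ∑ n ∈ Ico N₀ (N₀ + N), g n ≤ ∑ n ∈ Ico N₀ (N₀ + B * T), g n :=
        Finset.sum_le_sum_of_subset_of_nonneg hsub fun n _ _ => hg0 n
    _ = ∑ u ∈ range T, ∑ k ∈ range B, g (N₀ + (k + B * u)) := hblocks
    _ ≤ ∑ _u ∈ range T, (2 * M + (1 / α) * (1 + Real.log (1 / α))) := Finset.sum_le_sum fun u _ => hblock u
    _ = T * (2 * M + (1 / α) * (1 + Real.log (1 / α))) := by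
        rw [Finset.sum_const, Finset.card_range, nsmul_eq_mul]
    _ ≤ (4 * α * N + 1) * (2 * M + (1 / α) * (1 + Real.log (1 / α))) := by
        refine mul_le_mul_of_nonneg_right ?_ hX0
        rw [hT]; push_cast
        -- `N / B ≤ 4 α N`
        have hdiv : ((N / B : ℕ) : ℝ) ≤ (N : ℝ) / B := Nat.cast_div_le
        have hBr : (0 : ℝ) < B := by exact_mod_cast hBpos
        have hkey : (N : ℝ) / B ≤ 4 * α * N := by
          rw [div_le_iff₀ hBr]
          -- `1 ≤ 4 α B`
          have h4 : 1 ≤ 4 * α * B := by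
            rcases le_or_gt α (1 / 4) with hα4 | hα4
            · -- `B ≥ 1/(2α) - 1 ≥ 1/(4α)`
              have hfl : 1 / (2 * α) - 1 ≤ (B : ℝ) := by
                have := Nat.lt_floor_add_one (1 / (2 * α)); rw [← hB] at this; linarith
              have : 1 / (2 * α) - 1 ≥ 1 / (4 * α) := by
                rw [ge_iff_le, div_le_iff₀ (by positivity)]
                have : 1 / (2 * α) * (4 * α) = 2 := by field_simp; ring
                nlinarith [show (1 : ℝ) ≤ 1 / (4 * α) * 1 from by
                  rw [mul_one, le_div_iff₀ (by positivity)]; linarith]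
              have hge : 1 / (4 * α) ≤ (B : ℝ) := by linarith
              rw [div_le_iff₀ (by positivity)] at hge
              linarith
            · have : (1 : ℝ) ≤ B := by exact_mod_cast hB1
              nlinarith
          have hN0 : (0 : ℝ) ≤ N := Nat.cast_nonneg N
          nlinarith
        linarith

/-- **A short arc far from `ℤ`** (the count behind Bourgain 2013, (2.25)–(2.27), far case): if
`0 ≤ αn ≤ w` on the range and `‖β‖ ≥ 2w > 0`, then every phase `β ± αn` is at distance `≥ ‖β‖/2`
and `≥ w` from `ℤ`, so `∑_n min(M, 1/(2‖±αn + β‖)) ≤ 2N' min(M, 1/(4w), 1/(2‖β‖))`.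
[cite: Bourgain2013MoebiusWalsh, §2 (2.25)] -/
theorem sum_Ico_geomBound_far_le {α w : ℝ} (hα0 : 0 ≤ α) (hw : 0 < w) {β : ℝ} (hβ : 2 * w ≤ distInt β)
    {M : ℝ} (hM : 0 ≤ M) {N₀ N' : ℕ} (hn : α * ((N₀ : ℝ) + N') ≤ w) {ε : ℝ} (hε : ε = 1 ∨ ε = -1) :
    ∑ n ∈ Ico N₀ (N₀ + N'), geomBound M (ε * (α * n) + β) ≤
      2 * N' * geomBound (min M (1 / (4 * w))) β := by
  have hdβ : 0 < distInt β := lt_of_lt_of_le (by linarith) hβ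
  have hpt : ∀ n ∈ Ico N₀ (N₀ + N'), geomBound M (ε * (α * n) + β) ≤ 2 * geomBound (min M (1 / (4 * w))) β := by
    intro n hn'
    have hnr := (Finset.mem_Ico.1 hn').2
    have hnle : (n : ℝ) ≤ (N₀ : ℝ) + N' := by exact_mod_cast hnr.le
    have hx : |ε * (α * n)| ≤ w := by
      have : |ε * (α * n)| = α * n := by
        rcases hε with rfl | rfl
        · rw [one_mul, abs_of_nonneg (by positivity)]
        · rw [neg_one_mul, abs_neg, abs_of_nonneg (by positivity)]
      rw [this]
      exact le_trans (mul_le_mul_of_nonneg_left hnle hα0) hn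
    have hd : distInt β - w ≤ distInt (ε * (α * n) + β) := by
      have := distInt_sub_abs_le β (ε * (α * n))
      rw [add_comm] at this
      linarith
    have hdθ : 0 < distInt (ε * (α * n) + β) := by linarith
    have h1 : geomBound M (ε * (α * n) + β) ≤ 1 / (2 * distInt (ε * (α * n) + β)) := geomBound_le_inv M hdθ
    have h2 : 1 / (2 * distInt (ε * (α * n) + β)) ≤ 1 / distInt β := by
      apply one_div_le_one_div_of_le hdβ; linarith
    have h3 : 1 / (2 * distInt (ε * (α * n) + β)) ≤ 1 / (2 * w) := by
      apply one_div_le_one_div_of_le (by positivity); linarith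
    have h4 : geomBound M (ε * (α * n) + β) ≤ M := geomBound_le _ _
    -- compare with `2 min(min(M, 1/(4w)), 1/(2‖β‖))`
    set V : ℝ := min M (1 / (4 * w)) with hV
    have hgV : geomBound V β = min V (1 / (2 * distInt β)) := by
      unfold geomBound; rw [if_neg hdβ.ne']
    rw [hgV]
    have h5 : geomBound M (ε * (α * n) + β) ≤ 2 * V := by
      rw [hV, mul_min_of_nonneg _ _ (by norm_num : (0 : ℝ) ≤ 2)]
      refine le_min (by linarith) ?_
      rw [show (2 : ℝ) * (1 / (4 * w)) = 1 / (2 * w) by field_simp; ring]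
      exact h1.trans h3
    rcases le_total V (1 / (2 * distInt β)) with hc | hc
    · rw [min_eq_left hc]; exact h5
    · rw [min_eq_right hc]
      rw [show (2 : ℝ) * (1 / (2 * distInt β)) = 1 / distInt β by field_simp]
      exact h1.trans h2
  calc ∑ n ∈ Ico N₀ (N₀ + N'), geomBound M (ε * (α * n) + β)
      ≤ ∑ _n ∈ Ico N₀ (N₀ + N'), 2 * geomBound (min M (1 / (4 * w))) β := Finset.sum_le_sum hpt
    _ = 2 * N' * geomBound (min M (1 / (4 * w))) β := by
        rw [Finset.sum_const, Nat.card_Ico, nsmul_eq_mul,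
          show ((N₀ + N' - N₀ : ℕ) : ℝ) = N' by rw [Nat.add_sub_cancel_left]]; ring

/-! ### Weights near the lattice `(P/ℓ)ℤ`: covering by short windows -/

/-- **Frequencies `k` with `‖kℓ/P‖ < η'`, `|k| < F`, are covered by `≤ 2FL/P + 3` windows of
`≤ 2η'P + 1` consecutive integers** (group by the nearest integer to `kℓ/P`): if every such window
carries weight `≤ W`, the total weight of those `k` is `≤ (2FL/P + 3) W`.
[cite: Bourgain2013MoebiusWalsh, §2 (after (2.24)): "this restricts `k'` to at most `L²` intervals"] -/
theorem sum_filter_distInt_lt_le {c : ℤ → ℝ} (hc0 : ∀ k, 0 ≤ c k) (F : ℕ) {P : ℝ} (hP : 0 < P)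
    {ℓ : ℤ} (hℓ : ℓ ≠ 0) {L : ℝ} (hℓL : (ℓ.natAbs : ℝ) ≤ L) {η' : ℝ} (hη' : 0 < η') {W : ℝ} (hW : 0 ≤ W)
    (hwin : ∀ (a : ℤ) (J : ℕ), 1 ≤ J → (J : ℝ) ≤ 2 * η' * P + 1 → ∑ k ∈ Ico a (a + J), c k ≤ W) :
    ∑ k ∈ (Ioo (-(F : ℤ)) F).filter (fun k => distInt ((k * ℓ : ℤ) / P) < η'), c k ≤
      (2 * (F * L / P) + 3) * W := by
  classical
  set Z : ℕ := ⌊(F : ℝ) * L / P⌋₊ + 1 with hZ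
  set s := (Ioo (-(F : ℤ)) F).filter (fun k => distInt ((k * ℓ : ℤ) / P) < η') with hs
  have hℓr : (0 : ℝ) < |(ℓ : ℝ)| := by
    rw [abs_pos]; exact_mod_cast hℓ
  have hℓabs : |(ℓ : ℝ)| = (ℓ.natAbs : ℝ) := by rw [Nat.cast_natAbs, Int.cast_abs]
  have hℓ1 : (1 : ℝ) ≤ |(ℓ : ℝ)| := by
    rw [hℓabs]; exact_mod_cast Int.natAbs_pos.mpr hℓ
  have hL0 : 0 ≤ L := le_trans (Nat.cast_nonneg _) hℓL
  have hFLP : 0 ≤ (F : ℝ) * L / P := div_nonneg (mul_nonneg (Nat.cast_nonneg _) hL0) hP.le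
  -- the nearest integer is at most `Z` in absolute value
  have hmaps : ∀ k ∈ s, round (((k * ℓ : ℤ) : ℝ) / P) ∈ Icc (-(Z : ℤ)) Z := by
    intro k hk
    rw [hs, Finset.mem_filter, Finset.mem_Ioo] at hk
    set r : ℤ := round (((k * ℓ : ℤ) : ℝ) / P) with hr
    have hkF : |(k : ℝ)| ≤ F := by
      rw [abs_le]; constructor
      · have : (-(F : ℤ) : ℝ) ≤ (k : ℝ) := by exact_mod_cast hk.1.1.le
        push_cast at this; exact this
      · exact_mod_cast hk.1.2.le
    have hx : |((k * ℓ : ℤ) : ℝ) / P| ≤ (F : ℝ) * L / P := by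
      push_cast
      rw [abs_div, abs_mul, abs_of_pos hP]
      refine div_le_div_of_nonneg_right ?_ hP.le
      rw [hℓabs]
      exact mul_le_mul hkF hℓL (Nat.cast_nonneg _) (Nat.cast_nonneg _)
    have hr1 : |(r : ℝ)| ≤ (F : ℝ) * L / P + 1 / 2 := by
      have h1 := abs_sub_round (((k * ℓ : ℤ) : ℝ) / P)
      have h2 := abs_sub_abs_le_abs_sub ((r : ℤ) : ℝ) (((k * ℓ : ℤ) : ℝ) / P)
      rw [abs_sub_comm] at h1
      rw [← hr] at h1
      linarith
    have hZr : (F : ℝ) * L / P + 1 / 2 < (Z : ℝ) + 1 / 2 := by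
      rw [hZ]; push_cast
      have := Nat.lt_floor_add_one ((F : ℝ) * L / P)
      linarith
    have habs : |r| ≤ (Z : ℤ) := by
      have h3 : (((|r| : ℤ)) : ℝ) < ((Z : ℤ) : ℝ) + 1 := by
        rw [Int.cast_abs]; push_cast; linarith
      have h5 : |r| < (Z : ℤ) + 1 := by exact_mod_cast h3
      omega
    rw [Finset.mem_Icc]
    exact abs_le.mp habs
  rw [← Finset.sum_fiberwise_of_maps_to hmaps]
  -- each fibre lies in a window of length `⌈2η'P/|ℓ|⌉ ≤ 2η'P + 1`
  set J : ℕ := ⌈2 * η' * P⌉₊ with hJ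
  have h2ηP : 0 < 2 * η' * P := mul_pos (mul_pos two_pos hη') hP
  have hJ1 : 1 ≤ J := by
    rw [hJ]; exact Nat.one_le_ceil_iff.mpr h2ηP
  have hJle : (J : ℝ) ≤ 2 * η' * P + 1 := by
    rw [hJ]; exact (Nat.ceil_lt_add_one h2ηP.le).le
  have hfib : ∀ z ∈ Icc (-(Z : ℤ)) Z,
      ∑ k ∈ s.filter (fun k => round (((k * ℓ : ℤ) : ℝ) / P) = z), c k ≤ W := by
    intro z _
    set u : ℝ := (z : ℝ) * P / ℓ - η' * P / |(ℓ : ℝ)| with hu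
    refine le_trans (Finset.sum_le_sum_of_subset_of_nonneg (fun k hk => ?_) fun k _ _ => hc0 k)
      (hwin (⌊u⌋ + 1) J hJ1 hJle)
    rw [Finset.mem_filter] at hk
    have hnear := (Finset.mem_filter.1 hk.1).2
    have hz := hk.2
    -- `|kℓ/P - z| < η'`, i.e. `|k - zP/ℓ| < η'P/|ℓ|`
    have h1 : |((k * ℓ : ℤ) : ℝ) / P - z| < η' := by
      have : distInt (((k * ℓ : ℤ) : ℝ) / P) = |((k * ℓ : ℤ) : ℝ) / P - z| := by
        unfold distInt; rw [hz]
      rw [← this]; exact hnear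
    have hℓ0 : (ℓ : ℝ) ≠ 0 := by exact_mod_cast hℓ
    have h2 : |(k : ℝ) - (z : ℝ) * P / ℓ| < η' * P / |(ℓ : ℝ)| := by
      have he : (k : ℝ) - (z : ℝ) * P / ℓ = (((k * ℓ : ℤ) : ℝ) / P - z) * (P / ℓ) := by
        push_cast; field_simp
      rw [he, abs_mul, abs_div, abs_of_pos hP]
      have hPl : 0 < P / |(ℓ : ℝ)| := div_pos hP hℓr
      calc |((k * ℓ : ℤ) : ℝ) / P - z| * (P / |(ℓ : ℝ)|) < η' * (P / |(ℓ : ℝ)|) :=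
            mul_lt_mul_of_pos_right h1 hPl
        _ = η' * P / |(ℓ : ℝ)| := by ring
    obtain ⟨h2a, h2b⟩ := abs_lt.mp h2
    rw [Finset.mem_Ico]
    constructor
    · have hul : u < k := by rw [hu]; linarith
      have := Int.floor_lt.mpr hul
      omega
    · have h22 : 2 * η' * P / |(ℓ : ℝ)| = 2 * (η' * P / |(ℓ : ℝ)|) := by ring
      have hk2 : (k : ℝ) < u + 2 * η' * P / |(ℓ : ℝ)| := by rw [h22, hu]; linarith
      have hlen : 2 * η' * P / |(ℓ : ℝ)| ≤ J := by
        have : 2 * η' * P / |(ℓ : ℝ)| ≤ 2 * η' * P := div_le_self h2ηP.le hℓ1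
        exact this.trans (Nat.le_ceil _)
      have hk3 : (k : ℝ) < (⌊u⌋ : ℝ) + 1 + J := by
        have := Int.lt_floor_add_one u
        linarith
      have hk4 : k < ⌊u⌋ + 1 + J := by exact_mod_cast hk3
      exact hk4
  calc ∑ z ∈ Icc (-(Z : ℤ)) Z, ∑ k ∈ s.filter (fun k => round (((k * ℓ : ℤ) : ℝ) / P) = z), c k
      ≤ ∑ _z ∈ Icc (-(Z : ℤ)) Z, W := Finset.sum_le_sum hfib
    _ = ((2 * Z + 1 : ℕ) : ℝ) * W := by
        rw [Finset.sum_const, nsmul_eq_mul, Int.card_Icc]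
        congr 1
        norm_cast
        omega
    _ ≤ (2 * (F * L / P) + 3) * W := by
        refine mul_le_mul_of_nonneg_right ?_ hW
        push_cast
        rw [hZ]; push_cast
        have := Nat.floor_le hFLP
        linarith

/-! ### Dyadic layers of the majorant -/

/-- Pointwise layer-cake: `min(V, 1/(2‖x‖)) ≤ 1 + ∑_{j<J, 2^j<V} 2^j 𝟙[‖x‖ < 1/(2·2^j)]` whenever
`V ≤ 2^J`. [folklore] -/
theorem geomBound_le_one_add_sum_layers {V : ℝ} {J : ℕ} (hVJ : V ≤ 2 ^ J) (x : ℝ) :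
    geomBound V x ≤ 1 + ∑ j ∈ (range J).filter (fun j => (2 : ℝ) ^ j < V),
      (2 : ℝ) ^ j * (if distInt x < 1 / (2 * 2 ^ j) then 1 else 0) := by
  -- `y ≤ 1 + ∑_{j<J} 2^j 𝟙[2^j < y]` for `0 ≤ y ≤ 2^J`
  have key : ∀ (J : ℕ) (y : ℝ), y ≤ 2 ^ J →
      y ≤ 1 + ∑ j ∈ range J, (2 : ℝ) ^ j * (if (2 : ℝ) ^ j < y then 1 else 0) := by
    intro J
    induction J with
    | zero => intro y hy; simpa using hy
    | succ J ih =>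
      intro y hy
      rw [Finset.sum_range_succ]
      by_cases hyJ : y ≤ 2 ^ J
      · have h := ih y hyJ
        have : 0 ≤ (2 : ℝ) ^ J * (if (2 : ℝ) ^ J < y then 1 else 0) := by
          split_ifs <;> positivity
        linarith
      · have hlt : (2 : ℝ) ^ J < y := lt_of_not_ge hyJ
        rw [if_pos hlt, mul_one]
        have hall : ∀ j ∈ range J, (2 : ℝ) ^ j * (if (2 : ℝ) ^ j < y then 1 else 0) = 2 ^ j := by
          intro j hj
          rw [if_pos (lt_of_le_of_lt (pow_le_pow_right₀ (by norm_num) (Finset.mem_range.1 hj).le) hlt), mul_one]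
        rw [Finset.sum_congr rfl hall]
        have hgeom : ∑ j ∈ range J, (2 : ℝ) ^ j = 2 ^ J - 1 := by
          have := geom_sum_eq (show (2 : ℝ) ≠ 1 by norm_num) J
          rw [this]; ring
        rw [hgeom, pow_succ] at *
        linarith
  have hy : geomBound V x ≤ 2 ^ J := (geomBound_le V x).trans hVJ
  refine (key J _ hy).trans (add_le_add le_rfl ?_)
  rw [Finset.sum_filter]
  refine Finset.sum_le_sum fun j _ => ?_
  by_cases hjV : (2 : ℝ) ^ j < V
  · rw [if_pos hjV]
    refine mul_le_mul_of_nonneg_left ?_ (by positivity)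
    split_ifs with h1 h2
    · exact le_rfl
    · exfalso
      -- `2^j < min(V, 1/(2‖x‖))` forces `‖x‖ < 1/(2·2^j)`
      unfold geomBound at h1
      split_ifs at h1 with hx0
      · exact h2 (by rw [hx0]; positivity)
      · have hx : 0 < distInt x := lt_of_le_of_ne (distInt_nonneg _) (Ne.symm hx0)
        have h3 : (2 : ℝ) ^ j < 1 / (2 * distInt x) := lt_of_lt_of_le h1 (min_le_right _ _)
        apply h2
        rw [lt_div_iff₀ (by positivity)] at h3
        rw [lt_div_iff₀ (by positivity)]
        linarith
    · positivity
    · exact le_rfl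
  · rw [if_neg hjV]
    have : ¬ (2 : ℝ) ^ j < geomBound V x := fun h => hjV (lt_of_lt_of_le h (geomBound_le V x))
    rw [if_neg this, mul_zero]

/-- **Layer-cake for a weighted sum of the majorant**: for weights `c ≥ 0` and `V ≤ 2^J`,
`∑_k c(k) min(V, 1/(2‖x_k‖)) ≤ ∑_k c(k) + ∑_{j<J, 2^j<V} 2^j ∑_{k : ‖x_k‖ < 1/(2·2^j)} c(k)`. [folklore] -/
theorem sum_mul_geomBound_le_layers {ι : Type*} (s : Finset ι) {c : ι → ℝ} (hc0 : ∀ k, 0 ≤ c k)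
    {V : ℝ} {J : ℕ} (hVJ : V ≤ 2 ^ J) (x : ι → ℝ) :
    ∑ k ∈ s, c k * geomBound V (x k) ≤
      ∑ k ∈ s, c k + ∑ j ∈ (range J).filter (fun j => (2 : ℝ) ^ j < V),
        (2 : ℝ) ^ j * ∑ k ∈ s.filter (fun k => distInt (x k) < 1 / (2 * 2 ^ j)), c k := by
  classical
  calc ∑ k ∈ s, c k * geomBound V (x k)
      ≤ ∑ k ∈ s, c k * (1 + ∑ j ∈ (range J).filter (fun j => (2 : ℝ) ^ j < V),
          (2 : ℝ) ^ j * (if distInt (x k) < 1 / (2 * 2 ^ j) then 1 else 0)) :=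
        Finset.sum_le_sum fun k _ => mul_le_mul_of_nonneg_left (geomBound_le_one_add_sum_layers hVJ _) (hc0 k)
    _ = ∑ k ∈ s, c k + ∑ j ∈ (range J).filter (fun j => (2 : ℝ) ^ j < V),
          (2 : ℝ) ^ j * ∑ k ∈ s, c k * (if distInt (x k) < 1 / (2 * 2 ^ j) then 1 else 0) := by
        simp_rw [mul_add, mul_one, Finset.sum_add_distrib, Finset.mul_sum]
        rw [Finset.sum_comm]
        refine congrArg _ (Finset.sum_congr rfl fun j _ => Finset.sum_congr rfl fun k _ => by ring)
    _ = _ := by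
        congr 1
        refine Finset.sum_congr rfl fun j _ => ?_
        rw [Finset.sum_filter]
        congr 1
        refine Finset.sum_congr rfl fun k _ => ?_
        split_ifs <;> simp

/-! ### The sup route for the weighted `k'`-sum -/

/-- **`∑_{|k|<F} c(k) min(V, 1/(2‖kℓ/2^σ‖)) ≤ A_∞ (2F/2^σ + 2)(2^{v₂(ℓ)+1}V + 2^σ(1 + log 2^σ))`**
when `c ≤ A_∞` pointwise (the interval bound of `MoebiusWalshGeomSums` along `kℓ/2^σ`).
[cite: Bourgain2013MoebiusWalsh, §2 (2.27)] -/
theorem sum_Ioo_mul_geomBound_le_sup {c : ℤ → ℝ} {Ainf : ℝ} (hA0 : 0 ≤ Ainf) (hcA : ∀ k, c k ≤ Ainf)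
    (F σ : ℕ) {V : ℝ} (hV : 0 ≤ V) {ℓ : ℤ} (hℓ : ℓ ≠ 0) :
    ∑ k ∈ Ioo (-(F : ℤ)) F, c k * geomBound V (((k * ℓ : ℤ) : ℝ) / 2 ^ σ) ≤
      Ainf * ((2 * (F : ℝ)) / 2 ^ σ + 2) *
        (2 ^ (ℓ.natAbs.factorization 2 + 1) * V + 2 ^ σ * (1 + Real.log (2 ^ σ))) := by
  have hsub : Ioo (-(F : ℤ)) F ⊆ Ico (-(F : ℤ)) (-(F : ℤ) + (2 * F : ℕ)) := by
    intro k hk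
    rw [Finset.mem_Ioo] at hk
    rw [Finset.mem_Ico]; push_cast; constructor <;> linarith
  have hlog : 0 ≤ 1 + Real.log ((2 : ℝ) ^ σ) := by
    have : 0 ≤ Real.log ((2 : ℝ) ^ σ) := Real.log_nonneg (one_le_pow₀ (by norm_num)); linarith
  calc ∑ k ∈ Ioo (-(F : ℤ)) F, c k * geomBound V (((k * ℓ : ℤ) : ℝ) / 2 ^ σ)
      ≤ ∑ k ∈ Ioo (-(F : ℤ)) F, Ainf * geomBound V (((k * ℓ : ℤ) : ℝ) / 2 ^ σ) :=
        Finset.sum_le_sum fun k _ => mul_le_mul_of_nonneg_right (hcA k) (geomBound_nonneg hV _)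
    _ ≤ ∑ k ∈ Ico (-(F : ℤ)) (-(F : ℤ) + (2 * F : ℕ)), Ainf * geomBound V (((k * ℓ : ℤ) : ℝ) / 2 ^ σ) :=
        Finset.sum_le_sum_of_subset_of_nonneg hsub fun k _ _ => mul_nonneg hA0 (geomBound_nonneg hV _)
    _ = Ainf * ∑ j ∈ range (2 * F), geomBound V (((((-(F : ℤ) + j) * ℓ : ℤ)) : ℝ) / 2 ^ σ) := by
        rw [← Finset.mul_sum, sum_Ico_int_eq_sum_range]
    _ ≤ Ainf * (((2 * F : ℕ) : ℝ) / 2 ^ σ + 2) *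
          (2 ^ (ℓ.natAbs.factorization 2 + 1) * V + 2 ^ σ * (1 + Real.log (2 ^ σ))) := by
        rw [mul_assoc]
        refine mul_le_mul_of_nonneg_left ?_ hA0
        have h := sum_Ico_geomBound_mul_div_le (Int.natAbs_ne_zero.mpr hℓ) σ hV
          (-(((F : ℝ) * (ℓ.natAbs : ℕ)) / 2 ^ σ)) 0 (2 * F)
        rw [zero_add, ← Finset.range_eq_Ico] at h
        refine le_trans (le_of_eq (Finset.sum_congr rfl fun j _ => ?_)) h
        · have hcast : (((ℓ.natAbs : ℕ) : ℤ) : ℝ) = ((ℓ.natAbs : ℕ) : ℝ) := Int.cast_natCast _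
          rcases Int.natAbs_eq ℓ with h1 | h1
          · have hl : (ℓ : ℝ) = ((ℓ.natAbs : ℕ) : ℝ) := by rw [← hcast]; exact congrArg Int.cast h1
            congr 1
            push_cast; rw [hl]; ring
          · have hl : (ℓ : ℝ) = -((ℓ.natAbs : ℕ) : ℝ) := by
              rw [← hcast, ← Int.cast_neg]; exact congrArg Int.cast h1
            rw [← geomBound_neg]
            congr 1
            push_cast; rw [hl]; ring
    _ = _ := by push_cast; ring

/-! ### The high window: one pair of frequencies -/

/-- **One pair of frequencies, high window** (Bourgain 2013, (2.23)–(2.27), per pair). Frequencies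
`k ≠ k'` with `|k|, |k'| < F`, `4F ≤ Q = 2^{K+σ}`; `Δ = |k' - k| ∈ [2^d, 2^{d+1})`; phase
`((k'-k)n + k'ℓ2^K)/Q = ±(Δ/Q)n + k'ℓ/2^σ`; `n` ranges over `N' ≤ 2N - N₀` consecutive integers
below `2N`, `2^K ≤ N`. Then `d < K + σ` and the `n`-sum of `min(M, 1/(2‖phase‖))` is at most
* `(16FN/Q + 1)2M + 24N(1 + log Q)` if `Q ≤ 16N2^d` (many turns: `sum_Ico_geomBound_linear_le`),
* `2(2M + Q(1 + log Q)/2^d)𝟙[‖k'ℓ/2^σ‖ < 8·2^dN/Q] + 4N min(M, Q/(16·2^dN), 1/(2‖k'ℓ/2^σ‖))`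
  otherwise (a short arc: near the lattice `sum_Ico_geomBound_linear_le` with one block, far from
  it `sum_Ico_geomBound_far_le`). [cite: Bourgain2013MoebiusWalsh, §2 (2.23)–(2.27)] -/
theorem sum_Ico_geomBound_pair_high (σ K F : ℕ) (hF : 4 * F ≤ 2 ^ (K + σ)) {k k' : ℤ}
    (hk : k ∈ Ioo (-(F : ℤ)) F) (hk' : k' ∈ Ioo (-(F : ℤ)) F) (hne : k ≠ k')
    {M : ℝ} (hM : 0 ≤ M) {N N₀ N' : ℕ} (hN : 2 ^ K ≤ N) (hN' : N₀ + N' ≤ 2 * N) (ℓ : ℤ) {d : ℕ}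
    (hd : Nat.log 2 (Int.natAbs (k' - k)) = d) :
    d < K + σ ∧
    ∑ n ∈ Ico N₀ (N₀ + N'), geomBound M ((((k' - k) * n + k' * ℓ * 2 ^ K : ℤ) : ℝ) / 2 ^ (K + σ)) ≤
      if (2 : ℝ) ^ (K + σ) ≤ 16 * N * 2 ^ d then
        (16 * F * N / 2 ^ (K + σ) + 1) * (2 * M) + 24 * N * (1 + Real.log (2 ^ (K + σ)))
      else
        2 * (2 * M + 2 ^ (K + σ) * (1 + Real.log (2 ^ (K + σ))) / 2 ^ d) *
            (if distInt (((k' * ℓ : ℤ) : ℝ) / 2 ^ σ) < 8 * 2 ^ d * N / 2 ^ (K + σ) then 1 else 0) +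
          4 * N * geomBound (min M (2 ^ (K + σ) / (16 * 2 ^ d * N))) (((k' * ℓ : ℤ) : ℝ) / 2 ^ σ) := by
  set Q : ℝ := (2 : ℝ) ^ (K + σ) with hQ
  have hQ0 : 0 < Q := by positivity
  have hQσ : Q = 2 ^ K * 2 ^ σ := by rw [hQ, pow_add]
  set Δ : ℕ := Int.natAbs (k' - k) with hΔ
  rw [Finset.mem_Ioo] at hk hk'
  have hΔ1 : 1 ≤ Δ := Int.natAbs_pos.mpr (sub_ne_zero.mpr (Ne.symm hne))
  have hΔF : Δ < 2 * F := by
    have h1 : ((Δ : ℕ) : ℤ) < 2 * F := by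
      rw [hΔ, Int.natCast_natAbs, abs_lt]; constructor <;> omega
    exact_mod_cast h1
  have hΔQ : 2 * Δ < 2 ^ (K + σ) := by omega
  have h2d : 2 ^ d ≤ Δ := by rw [← hd]; exact Nat.pow_log_le_self 2 (by omega)
  have hd2 : Δ < 2 ^ (d + 1) := by rw [← hd]; exact Nat.lt_pow_succ_log_self one_lt_two _
  have hdK : d < K + σ := by
    have : 2 ^ d < 2 ^ (K + σ) := by omega
    exact (Nat.pow_lt_pow_iff_right (by norm_num)).1 this
  refine ⟨hdK, ?_⟩
  -- real-number versions
  have hΔr1 : (1 : ℝ) ≤ Δ := by exact_mod_cast hΔ1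
  have hΔrF : (Δ : ℝ) < 2 * F := by exact_mod_cast hΔF
  have hΔrQ : 2 * (Δ : ℝ) < Q := by rw [hQ]; exact_mod_cast hΔQ
  have h2dr : (2 : ℝ) ^ d ≤ Δ := by exact_mod_cast h2d
  have hd2r : (Δ : ℝ) < 2 * 2 ^ d := by
    have : ((Δ : ℕ) : ℝ) < ((2 ^ (d + 1) : ℕ) : ℝ) := by exact_mod_cast hd2
    rw [pow_succ] at this; push_cast at this; linarith
  have hNr : ((2 ^ K : ℕ) : ℝ) ≤ N := by exact_mod_cast hN
  push_cast at hNr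
  have hN'r : (N₀ : ℝ) + N' ≤ 2 * N := by exact_mod_cast hN'
  have hD0 : (0 : ℝ) < 2 ^ d := by positivity
  set lam : ℝ := 1 + Real.log Q with hlam
  have hlam0 : 1 ≤ lam := by
    have : 0 ≤ Real.log Q := Real.log_nonneg (by rw [hQ]; exact one_le_pow₀ (by norm_num)); rw [hlam]; linarith
  -- the linear phase
  set α : ℝ := (Δ : ℝ) / Q with hα
  have hα0 : 0 < α := by positivity
  have hα2 : α ≤ 1 / 2 := by
    rw [hα, div_le_iff₀ hQ0]; linarith
  have hαinv : 1 / α = Q / Δ := by rw [hα, one_div_div]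
  have hαinvQ : 1 / α ≤ Q := by rw [hαinv]; exact div_le_self hQ0.le hΔr1
  have hlogα : 1 + Real.log (1 / α) ≤ lam := by
    rw [hlam]; have := Real.log_le_log (by positivity) hαinvQ; linarith
  have hαF : α ≤ 2 * F / Q := by rw [hα]; exact div_le_div_of_nonneg_right hΔrF.le hQ0.le
  set β : ℝ := ((k' * ℓ : ℤ) : ℝ) / 2 ^ σ with hβ
  -- sign of `k' - k` and the normal form of the phase
  have hphase : ∃ ε : ℝ, (ε = 1 ∨ ε = -1) ∧ ∀ n : ℕ,
      (((k' - k) * n + k' * ℓ * 2 ^ K : ℤ) : ℝ) / 2 ^ (K + σ) = ε * (α * n) + β := by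
    have h2K : (2 : ℝ) ^ K ≠ 0 := by positivity
    have h2σ : (2 : ℝ) ^ σ ≠ 0 := by positivity
    rcases Int.natAbs_eq (k' - k) with h1 | h1
    · refine ⟨1, Or.inl rfl, fun n => ?_⟩
      rw [hα, hβ, ← hQ, hQσ]
      have hcast : (((Δ : ℕ) : ℤ) : ℝ) = ((Δ : ℕ) : ℝ) := Int.cast_natCast _
      have : ((k' : ℝ) - k) = (Δ : ℝ) := by
        rw [← hcast, ← Int.cast_sub]; exact congrArg Int.cast h1
      push_cast; rw [this]; field_simp
    · refine ⟨-1, Or.inr rfl, fun n => ?_⟩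
      rw [hα, hβ, ← hQ, hQσ]
      have hcast : (((Δ : ℕ) : ℤ) : ℝ) = ((Δ : ℕ) : ℝ) := Int.cast_natCast _
      have : ((k' : ℝ) - k) = -(Δ : ℝ) := by
        rw [← hcast, ← Int.cast_neg, ← Int.cast_sub]; exact congrArg Int.cast h1
      push_cast; rw [this]; field_simp
  obtain ⟨ε, hε, hphn⟩ := hphase
  rw [Finset.sum_congr rfl fun n _ => by rw [hphn n]]
  -- the linear bound, for either sign
  have hlin : ∑ n ∈ Ico N₀ (N₀ + N'), geomBound M (ε * (α * n) + β) ≤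
      (4 * α * N' + 1) * (2 * M + (1 / α) * (1 + Real.log (1 / α))) := by
    rcases hε with rfl | rfl
    · simp_rw [one_mul]; exact sum_Ico_geomBound_linear_le hα0 hα2 β hM N₀ N'
    · have : ∀ n : ℕ, geomBound M (-1 * (α * n) + β) = geomBound M (α * n + -β) := by
        intro n; rw [← geomBound_neg]; congr 1; ring
      simp_rw [this]; exact sum_Ico_geomBound_linear_le hα0 hα2 (-β) hM N₀ N'
  have hX0 : 0 ≤ 2 * M + (1 / α) * (1 + Real.log (1 / α)) := by
    have : 0 ≤ Real.log (1 / α) := Real.log_nonneg (by rw [le_div_iff₀ hα0]; linarith)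
    positivity
  have hN'2 : (N' : ℝ) ≤ 2 * N := by linarith [show (0:ℝ) ≤ N₀ from Nat.cast_nonneg _]
  split_ifs with hreg hnear
  · -- regime A: `Q ≤ 16 N 2^d`, so `1/α ≤ 16 N`
    have hinv : 1 / α ≤ 16 * N := by
      rw [hαinv, div_le_iff₀ (by positivity)]
      calc Q ≤ 16 * N * 2 ^ d := hreg
        _ ≤ 16 * N * Δ := by gcongr
    refine hlin.trans ?_
    have h1 : 4 * α * N' + 1 ≤ 16 * F * N / Q + 1 := by
      have : 4 * α * N' ≤ 4 * (2 * F / Q) * (2 * N) := by gcongr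
      linarith [show 4 * (2 * F / Q) * (2 * (N : ℝ)) = 16 * F * N / Q by ring]
    have hlog0 : 0 ≤ 1 + Real.log (1 / α) := by
      have : 0 ≤ Real.log (1 / α) := Real.log_nonneg (by rw [le_div_iff₀ hα0]; linarith); linarith
    calc (4 * α * N' + 1) * (2 * M + 1 / α * (1 + Real.log (1 / α)))
        = (4 * α * N' + 1) * (2 * M) + (4 * N' + 1 / α) * (1 + Real.log (1 / α)) := by
          field_simp
      _ ≤ (16 * F * N / Q + 1) * (2 * M) + (24 * N) * lam := by
          have h2 : 4 * (N' : ℝ) + 1 / α ≤ 24 * N := by linarith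
          exact add_le_add (mul_le_mul_of_nonneg_right h1 (by positivity))
            (mul_le_mul h2 hlogα hlog0 (by positivity))
      _ = (16 * F * N / Q + 1) * (2 * M) + 24 * N * lam := by ring
  · -- regime B, near the lattice
    have hw : 4 * α * N' + 1 ≤ 2 := by
      have h16 : 16 * N * (2 : ℝ) ^ d < Q := lt_of_not_ge hreg
      have : α * N' ≤ 1 / 4 := by
        calc α * N' ≤ (2 * 2 ^ d / Q) * (2 * N) := by
              refine mul_le_mul ?_ hN'2 (Nat.cast_nonneg _) (by positivity)
              rw [hα]; exact div_le_div_of_nonneg_right hd2r.le hQ0.le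
          _ = (16 * N * 2 ^ d / Q) / 4 := by ring
          _ ≤ 1 / 4 := by
              have : 16 * (N : ℝ) * 2 ^ d / Q ≤ 1 := by rw [div_le_one hQ0]; linarith
              linarith
      linarith
    have hinv : 1 / α ≤ Q / 2 ^ d := by
      rw [hαinv]; exact div_le_div_of_nonneg_left hQ0.le hD0 h2dr
    refine hlin.trans ?_
    rw [mul_one]
    have hg0 : 0 ≤ 4 * (N : ℝ) * geomBound (min M (Q / (16 * 2 ^ d * N))) β :=
      mul_nonneg (by positivity) (geomBound_nonneg (le_min hM (by positivity)) _)
    calc (4 * α * N' + 1) * (2 * M + 1 / α * (1 + Real.log (1 / α)))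
        ≤ 2 * (2 * M + Q / 2 ^ d * lam) := by
          refine mul_le_mul hw (add_le_add le_rfl ?_) hX0 (by norm_num)
          exact mul_le_mul hinv hlogα (by
            have : 0 ≤ Real.log (1 / α) := Real.log_nonneg (by rw [le_div_iff₀ hα0]; linarith); linarith)
            (by positivity)
      _ = 2 * (2 * M + Q * lam / 2 ^ d) := by ring
      _ ≤ 2 * (2 * M + Q * lam / 2 ^ d) + 4 * N * geomBound (min M (Q / (16 * 2 ^ d * N))) β :=
          le_add_of_nonneg_right hg0
  · -- regime B, far from the lattice
    have h16 : 16 * N * (2 : ℝ) ^ d < Q := lt_of_not_ge hreg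
    have hNpos : (0 : ℝ) < N := lt_of_lt_of_le (by positivity) hNr
    set w : ℝ := 4 * 2 ^ d * N / Q with hwdef
    have hw0 : 0 < w := by positivity
    have hfar : 2 * w ≤ distInt β := by
      have := not_lt.mp hnear
      rw [hwdef]; linarith [show 2 * (4 * 2 ^ d * N / Q) = 8 * 2 ^ d * (N : ℝ) / Q by ring]
    have hn : α * ((N₀ : ℝ) + N') ≤ w := by
      calc α * ((N₀ : ℝ) + N') ≤ (2 * 2 ^ d / Q) * (2 * N) := by
            refine mul_le_mul ?_ hN'r (by positivity) (by positivity)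
            rw [hα]; exact div_le_div_of_nonneg_right hd2r.le hQ0.le
        _ = w := by rw [hwdef]; ring
    have h := sum_Ico_geomBound_far_le hα0.le hw0 hfar hM hn hε
    rw [mul_zero, zero_add]
    refine h.trans ?_
    have hweq : 1 / (4 * w) = Q / (16 * 2 ^ d * N) := by
      rw [hwdef]; field_simp; ring
    rw [hweq]
    refine mul_le_mul_of_nonneg_right (by linarith) (geomBound_nonneg (le_min hM (by positivity)) _)

/-! ### The high window: the assembled count -/

/-- Swapping the two variables of an off-diagonal double sum. [folklore] -/
theorem sum_erase_comm' {ι : Type*} [DecidableEq ι] {R : Finset ι} (f : ι → ι → ℝ) :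
    ∑ h ∈ R, ∑ h' ∈ R.erase h, f h h' = ∑ h' ∈ R, ∑ h ∈ R.erase h', f h h' := by
  have h1 : ∀ h ∈ R, ∑ h' ∈ R.erase h, f h h' = ∑ h' ∈ R, f h h' - f h h :=
    fun h hh => Finset.sum_erase_eq_sub hh
  have h2 : ∀ h' ∈ R, ∑ h ∈ R.erase h', f h h' = ∑ h ∈ R, f h h' - f h' h' :=
    fun h' hh' => Finset.sum_erase_eq_sub hh'
  rw [Finset.sum_congr rfl h1, Finset.sum_congr rfl h2, Finset.sum_sub_distrib, Finset.sum_sub_distrib,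
    Finset.sum_comm]

/-- Frequencies `k ≠ k'` of the window with `|k' - k| ∈ [2^d, 2^{d+1})` lie in two windows of length
`2^d` next to `k'`. [folklore] -/
theorem mem_windows_of_log_eq {k k' : ℤ} (hne : k ≠ k') {d : ℕ} (hd : Nat.log 2 (Int.natAbs (k' - k)) = d) :
    k ∈ Ico (k' + 2 ^ d) (k' + 2 ^ d + (2 ^ d : ℕ)) ∪
      Ico (k' - 2 ^ (d + 1) + 1) (k' - 2 ^ (d + 1) + 1 + (2 ^ d : ℕ)) := by
  set Δ : ℕ := Int.natAbs (k' - k) with hΔ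
  have hΔ1 : 1 ≤ Δ := Int.natAbs_pos.mpr (sub_ne_zero.mpr (Ne.symm hne))
  have h2d : 2 ^ d ≤ Δ := by rw [← hd]; exact Nat.pow_log_le_self 2 (by omega)
  have hd2 : Δ < 2 ^ (d + 1) := by rw [← hd]; exact Nat.lt_pow_succ_log_self one_lt_two _
  have h2dz : ((2 ^ d : ℕ) : ℤ) ≤ (Δ : ℤ) := by exact_mod_cast h2d
  have hd2z : (Δ : ℤ) < ((2 ^ (d + 1) : ℕ) : ℤ) := by exact_mod_cast hd2
  push_cast at h2dz hd2z
  rw [pow_succ] at hd2z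
  have hΔz : ((Δ : ℕ) : ℤ) = |k' - k| := by rw [hΔ, Int.natCast_natAbs]
  rw [Finset.mem_union, Finset.mem_Ico, Finset.mem_Ico]
  push_cast
  rcases le_or_gt 0 (k' - k) with h0 | h0
  · rw [abs_of_nonneg h0] at hΔz
    right; constructor <;> omega
  · rw [abs_of_neg h0] at hΔz
    left; constructor <;> omega

set_option maxHeartbeats 800000 in
/-- **Bourgain 2013, §2, the counting core of the HIGH window `K ≥ μ - ρ` ((2.23)–(2.27)), abstract
mollifier-free form.** Frequencies are integers `k` with `|k| < F`, `4F ≤ Q = 2^{K+σ}`; the weights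
`c(k) ≥ 0` have total mass `≤ A₁` on the window, sup `≤ A_∞`, and mass `≤ B J^κ` on every window of
`J ≤ 4Q` consecutive integers (`0 ≤ κ ≤ 1/2`); for `c(k) = |Ŵ_{S'}(k)|` (the localised substitute
of Lemma 5, tree `MoebiusWalshLocalised`) these are Lemma 5 (1.11)/(2.10), Lemma 2 (2.9) and
Lemma 6 of the paper. The `n`-range is any `N' ≤ 2N - N₀` consecutive integers below `2N` with
`2^K ≤ N`, the shift is `0 < |ℓ| ≤ L`, `D₀ ≥ 1` is a free threshold (`L^C` in the paper). Then,
with `P = 2^σ`, `R = 2^K`, `λ = 1 + log Q`, `Z₁ = 2FL/P + 3`, `Z₂ = 2F/P + 2`,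

  `∑_n ∑_{k ≠ k'} c(k)c(k') min(M, 1/(2‖((k'-k)n + k'ℓ2^K)/Q‖)) ≤ (K+σ)·(T_A + T_{B1} + T_{B2})`,

where (pairs grouped by `|k'-k| ∈ [D, 2D)`, `D = 2^d`, `d < K + σ`)
* `T_A = A₁²((16FN/Q + 1)2M + 24Nλ)` — many turns, `D ≥ Q/(16N)` ((2.24));
* `T_{B1} = 136B²Z₁M(Q/16N)^{2κ}(N/R)^κ + 68B²Z₁Qλ D₀^{2κ-1}(N/R)^κ + 8BNA₁(Q/16N)^κ
           + 16B²N(K+σ)Z₁P^κ(Q/16N)^{1-κ}D₀^{2κ-1}` — a short arc, `D₀ ≤ D < Q/(16N)` ((2.25)–(2.26):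
  near the lattice `(P/ℓ)ℤ` the `k'` are confined to `Z₁` short windows, far from it the lowered cap
  is summed over dyadic layers, both with the window bound `B J^κ`);
* `T_{B2} = 144BZ₁A_∞MD₀^{1+κ}N/R + 72BZ₁A_∞λD₀^κQN/R + 8BD₀^κNA_∞Z₂(2LM + Pλ)` — `D < D₀`
  ((2.27): the same with the sup bound).
With `P = ML^{1+ε}`, `M/L ≤ R ≤ N/L`, `F = 2^{t+1}P`, `A₁ ≲ KP^κ`, `D₀ = L^C` every term is
`≪ MNL · λ L^{O(C)} (M^{-(1-2κ)} + D₀^{-(1-2κ)}L^{O(1)} + A_∞ D₀^{1+κ})`, i.e. (2.28) for `K ≥ μ - ρ`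
up to the logarithm. [cite: Bourgain2013MoebiusWalsh, §2 (2.23)–(2.28)] -/
theorem typeII_count_high (σ K F : ℕ) (hF : 4 * F ≤ 2 ^ (K + σ)) {c : ℤ → ℝ} (hc0 : ∀ k, 0 ≤ c k)
    {A₁ Ainf B κ : ℝ} (hκ0 : 0 ≤ κ) (hκ : κ ≤ 1 / 2) (hB0 : 0 ≤ B) (hA0 : 0 ≤ Ainf)
    (hA₁ : ∑ k ∈ Ioo (-(F : ℤ)) F, c k ≤ A₁) (hAinf : ∀ k, c k ≤ Ainf)
    (hBint : ∀ (a : ℤ) (J : ℕ), 1 ≤ J → J ≤ 4 * 2 ^ (K + σ) →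
      ∑ k ∈ Ico a (a + J), c k ≤ B * (J : ℝ) ^ κ)
    {M : ℝ} (hM : 0 ≤ M) {N N₀ N' : ℕ} (hN : 2 ^ K ≤ N) (hN' : N₀ + N' ≤ 2 * N)
    {ℓ : ℤ} (hℓ : ℓ ≠ 0) {L : ℝ} (hℓL : (ℓ.natAbs : ℝ) ≤ L) {D₀ : ℕ} (hD₀ : 1 ≤ D₀) :
    ∑ n ∈ Ico N₀ (N₀ + N'), ∑ k ∈ Ioo (-(F : ℤ)) F, ∑ k' ∈ (Ioo (-(F : ℤ)) F).erase k,
        c k * c k' * geomBound M ((((k' - k) * n + k' * ℓ * 2 ^ K : ℤ) : ℝ) / 2 ^ (K + σ)) ≤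
      ((K + σ : ℕ) : ℝ) *
        (A₁ ^ 2 * ((16 * F * N / 2 ^ (K + σ) + 1) * (2 * M) + 24 * N * (1 + Real.log (2 ^ (K + σ)))) +
        (136 * B ^ 2 * (2 * (F * L / 2 ^ σ) + 3) * M * ((2 : ℝ) ^ (K + σ) / (16 * N)) ^ (2 * κ) *
              ((N : ℝ) / 2 ^ K) ^ κ +
            68 * B ^ 2 * (2 * (F * L / 2 ^ σ) + 3) * 2 ^ (K + σ) * (1 + Real.log (2 ^ (K + σ))) *
              (D₀ : ℝ) ^ (2 * κ - 1) * ((N : ℝ) / 2 ^ K) ^ κ +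
            8 * B * N * A₁ * ((2 : ℝ) ^ (K + σ) / (16 * N)) ^ κ +
            16 * B ^ 2 * N * (K + σ) * (2 * (F * L / 2 ^ σ) + 3) * ((2 : ℝ) ^ σ) ^ κ *
              ((2 : ℝ) ^ (K + σ) / (16 * N)) ^ (1 - κ) * (D₀ : ℝ) ^ (2 * κ - 1)) +
        (144 * B * (2 * (F * L / 2 ^ σ) + 3) * Ainf * M * (D₀ : ℝ) ^ (1 + κ) * N / 2 ^ K +
            72 * B * (2 * (F * L / 2 ^ σ) + 3) * Ainf * (1 + Real.log (2 ^ (K + σ))) * (D₀ : ℝ) ^ κ *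
              2 ^ (K + σ) * N / 2 ^ K +
            8 * B * (D₀ : ℝ) ^ κ * N * Ainf * (2 * F / 2 ^ σ + 2) *
              (2 * L * M + 2 ^ σ * (1 + Real.log (2 ^ (K + σ)))))) := by
  classical
  -- notation and basic positivity
  set 𝓚 : Finset ℤ := Ioo (-(F : ℤ)) F with h𝓚
  set Qr : ℝ := (2 : ℝ) ^ (K + σ) with hQr
  set P : ℝ := (2 : ℝ) ^ σ with hP
  set R : ℝ := (2 : ℝ) ^ K with hR
  set lam : ℝ := 1 + Real.log Qr with hlam
  set Z₁ : ℝ := 2 * (F * L / P) + 3 with hZ₁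
  set Z₂ : ℝ := 2 * F / P + 2 with hZ₂
  have hQ0 : 0 < Qr := by positivity
  have hP0 : 0 < P := by positivity
  have hR0 : 0 < R := by positivity
  have hQPR : Qr = R * P := by rw [hQr, hR, hP, pow_add]
  have hlog0 : 0 ≤ Real.log Qr := Real.log_nonneg (by rw [hQr]; exact one_le_pow₀ (by norm_num))
  have hlam1 : 1 ≤ lam := by rw [hlam]; linarith
  have hL0 : 0 ≤ L := le_trans (Nat.cast_nonneg _) hℓL
  have hZ₁0 : 0 ≤ Z₁ := by rw [hZ₁]; positivity
  have hZ₂0 : 0 ≤ Z₂ := by rw [hZ₂]; positivity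
  have hNr : R ≤ N := by rw [hR]; exact_mod_cast hN
  have hN0 : (0 : ℝ) < N := lt_of_lt_of_le hR0 hNr
  have hN1 : 1 ≤ (N : ℝ) / R := by rw [le_div_iff₀ hR0]; linarith
  have hA₁0 : 0 ≤ A₁ := le_trans (Finset.sum_nonneg fun k _ => hc0 k) hA₁
  have hD₀r : (1 : ℝ) ≤ D₀ := by exact_mod_cast hD₀
  have hFQ : 4 * (F : ℝ) ≤ Qr := by rw [hQr]; exact_mod_cast hF
  -- the three regime bounds
  set XA : ℝ := (16 * F * N / Qr + 1) * (2 * M) + 24 * N * lam with hXA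
  have hXA0 : 0 ≤ XA := by rw [hXA]; positivity
  set TA : ℝ := A₁ ^ 2 * XA with hTA
  set TB1 : ℝ := 136 * B ^ 2 * Z₁ * M * (Qr / (16 * N)) ^ (2 * κ) * ((N : ℝ) / R) ^ κ +
      68 * B ^ 2 * Z₁ * Qr * lam * (D₀ : ℝ) ^ (2 * κ - 1) * ((N : ℝ) / R) ^ κ +
      8 * B * N * A₁ * (Qr / (16 * N)) ^ κ +
      16 * B ^ 2 * N * (K + σ) * Z₁ * P ^ κ * (Qr / (16 * N)) ^ (1 - κ) * (D₀ : ℝ) ^ (2 * κ - 1) with hTB1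
  set TB2 : ℝ := 144 * B * Z₁ * Ainf * M * (D₀ : ℝ) ^ (1 + κ) * N / R +
      72 * B * Z₁ * Ainf * lam * (D₀ : ℝ) ^ κ * Qr * N / R +
      8 * B * (D₀ : ℝ) ^ κ * N * Ainf * Z₂ * (2 * L * M + P * lam) with hTB2
  have hTA0 : 0 ≤ TA := by rw [hTA]; positivity
  have hTB10 : 0 ≤ TB1 := by rw [hTB1]; positivity
  have hTB20 : 0 ≤ TB2 := by rw [hTB2]; positivity
  -- the per-pair majorant `Ψ d k'` and the class weights `WD d`
  let dlog : ℤ → ℤ → ℕ := fun k k' => Nat.log 2 (Int.natAbs (k' - k))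
  let V : ℕ → ℝ := fun d => min M (Qr / (16 * 2 ^ d * N))
  let Ψ : ℕ → ℤ → ℝ := fun d k' =>
    if Qr ≤ 16 * N * 2 ^ d then XA
    else 2 * (2 * M + Qr * lam / 2 ^ d) *
        (if distInt (((k' * ℓ : ℤ) : ℝ) / P) < 8 * 2 ^ d * N / Qr then 1 else 0) +
      4 * N * geomBound (V d) (((k' * ℓ : ℤ) : ℝ) / P)
  have hV0 : ∀ d, 0 ≤ V d := fun d => le_min hM (by positivity)
  have hΨ0 : ∀ d k', 0 ≤ Ψ d k' := by
    intro d k'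
    simp only [Ψ]
    split_ifs
    · exact hXA0
    · have := geomBound_nonneg (hV0 d) (((k' * ℓ : ℤ) : ℝ) / P); positivity
    · have := geomBound_nonneg (hV0 d) (((k' * ℓ : ℤ) : ℝ) / P); positivity
  let WD : ℕ → ℝ := fun d => if Qr ≤ 16 * N * 2 ^ d then A₁ else 2 * B * ((2 : ℝ) ^ d) ^ κ
  have hWD0 : ∀ d, 0 ≤ WD d := by intro d; simp only [WD]; split_ifs <;> positivity
  -- Step 1: one pair
  have hpair : ∀ k' ∈ 𝓚, ∀ k ∈ 𝓚.erase k', dlog k k' < K + σ ∧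
      ∑ n ∈ Ico N₀ (N₀ + N'), geomBound M ((((k' - k) * n + k' * ℓ * 2 ^ K : ℤ) : ℝ) / 2 ^ (K + σ)) ≤
        Ψ (dlog k k') k' := by
    intro k' hk' k hk
    have hk2 := Finset.mem_erase.1 hk
    have h := sum_Ico_geomBound_pair_high σ K F hF hk2.2 hk' hk2.1 hM hN hN' ℓ (d := dlog k k') rfl
    refine ⟨h.1, h.2.trans (le_of_eq ?_)⟩
    simp only [Ψ, V, ← hQr, ← hP, hlam]
    split_ifs <;> ring
  -- Step 2: the class weights
  have hclassA : ∀ k' ∈ 𝓚, ∀ d, ∑ k ∈ (𝓚.erase k').filter (fun k => dlog k k' = d), c k ≤ A₁ :=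
    fun k' _ d => le_trans (Finset.sum_le_sum_of_subset_of_nonneg
      ((Finset.filter_subset _ _).trans (Finset.erase_subset _ _)) fun k _ _ => hc0 k) hA₁
  have hclassB : ∀ k' ∈ 𝓚, ∀ d < K + σ,
      ∑ k ∈ (𝓚.erase k').filter (fun k => dlog k k' = d), c k ≤ 2 * B * ((2 : ℝ) ^ d) ^ κ := by
    intro k' _ d hd
    have h2dQ : 2 ^ d ≤ 4 * 2 ^ (K + σ) :=
      (Nat.pow_le_pow_right two_pos hd.le).trans (Nat.le_mul_of_pos_left _ (by norm_num))
    have h2d1 : 1 ≤ 2 ^ d := Nat.one_le_two_pow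
    set s₁ := Ico (k' + 2 ^ d) (k' + 2 ^ d + (2 ^ d : ℕ)) with hs₁
    set s₂ := Ico (k' - 2 ^ (d + 1) + 1) (k' - 2 ^ (d + 1) + 1 + (2 ^ d : ℕ)) with hs₂
    have hsub : (𝓚.erase k').filter (fun k => dlog k k' = d) ⊆ s₁ ∪ s₂ := by
      intro k hk
      rw [Finset.mem_filter, Finset.mem_erase] at hk
      exact mem_windows_of_log_eq hk.1.1 hk.2
    have hb₁ := hBint (k' + 2 ^ d) (2 ^ d) h2d1 h2dQ
    have hb₂ := hBint (k' - 2 ^ (d + 1) + 1) (2 ^ d) h2d1 h2dQ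
    push_cast at hb₁ hb₂
    calc ∑ k ∈ (𝓚.erase k').filter (fun k => dlog k k' = d), c k
        ≤ ∑ k ∈ s₁ ∪ s₂, c k := Finset.sum_le_sum_of_subset_of_nonneg hsub fun k _ _ => hc0 k
      _ ≤ ∑ k ∈ s₁, c k + ∑ k ∈ s₂, c k := by
          rw [← Finset.sum_union_inter]
          exact le_add_of_nonneg_right (Finset.sum_nonneg fun k _ => hc0 k)
      _ ≤ B * ((2 : ℝ) ^ d) ^ κ + B * ((2 : ℝ) ^ d) ^ κ := add_le_add hb₁ hb₂
      _ = 2 * B * ((2 : ℝ) ^ d) ^ κ := by ring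
  have hclass : ∀ k' ∈ 𝓚, ∀ d < K + σ,
      ∑ k ∈ (𝓚.erase k').filter (fun k => dlog k k' = d), c k ≤ WD d := by
    intro k' hk' d hd
    simp only [WD]; split_ifs
    · exact hclassA k' hk' d
    · exact hclassB k' hk' d hd
  -- Step 3: rearrangement `LHS ≤ ∑_d WD d ∑_{k'} c k' Ψ d k'`
  have hstep3 : ∑ n ∈ Ico N₀ (N₀ + N'), ∑ k ∈ 𝓚, ∑ k' ∈ 𝓚.erase k,
      c k * c k' * geomBound M ((((k' - k) * n + k' * ℓ * 2 ^ K : ℤ) : ℝ) / 2 ^ (K + σ)) ≤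
      ∑ d ∈ range (K + σ), WD d * ∑ k' ∈ 𝓚, c k' * Ψ d k' := by
    rw [Finset.sum_comm]
    simp_rw [Finset.sum_comm (s := Ico N₀ (N₀ + N')), ← Finset.mul_sum]
    rw [sum_erase_comm' (fun k k' => c k * c k' *
      ∑ n ∈ Ico N₀ (N₀ + N'), geomBound M ((((k' - k) * n + k' * ℓ * 2 ^ K : ℤ) : ℝ) / 2 ^ (K + σ)))]
    calc ∑ k' ∈ 𝓚, ∑ k ∈ 𝓚.erase k', c k * c k' *
          ∑ n ∈ Ico N₀ (N₀ + N'), geomBound M ((((k' - k) * n + k' * ℓ * 2 ^ K : ℤ) : ℝ) / 2 ^ (K + σ))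
        ≤ ∑ k' ∈ 𝓚, ∑ k ∈ 𝓚.erase k', c k' * (c k * Ψ (dlog k k') k') :=
          Finset.sum_le_sum fun k' hk' => Finset.sum_le_sum fun k hk => by
            have := mul_le_mul_of_nonneg_left (hpair k' hk' k hk).2 (mul_nonneg (hc0 k) (hc0 k'))
            linarith [this]
      _ = ∑ k' ∈ 𝓚, c k' * ∑ k ∈ 𝓚.erase k', c k * Ψ (dlog k k') k' := by
          simp_rw [Finset.mul_sum]
      _ ≤ ∑ k' ∈ 𝓚, c k' * ∑ d ∈ range (K + σ), Ψ d k' * WD d := by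
          refine Finset.sum_le_sum fun k' hk' => mul_le_mul_of_nonneg_left ?_ (hc0 k')
          have hmaps : ∀ k ∈ 𝓚.erase k', dlog k k' ∈ range (K + σ) :=
            fun k hk => Finset.mem_range.2 (hpair k' hk' k hk).1
          rw [← Finset.sum_fiberwise_of_maps_to hmaps]
          refine Finset.sum_le_sum fun d hd => ?_
          calc ∑ k ∈ (𝓚.erase k').filter (fun k => dlog k k' = d), c k * Ψ (dlog k k') k'
              = (∑ k ∈ (𝓚.erase k').filter (fun k => dlog k k' = d), c k) * Ψ d k' := by
                rw [Finset.sum_mul]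
                exact Finset.sum_congr rfl fun k hk => by rw [(Finset.mem_filter.1 hk).2]
            _ ≤ WD d * Ψ d k' :=
                mul_le_mul_of_nonneg_right (hclass k' hk' d (Finset.mem_range.1 hd)) (hΨ0 d k')
            _ = Ψ d k' * WD d := mul_comm _ _
      _ = ∑ d ∈ range (K + σ), WD d * ∑ k' ∈ 𝓚, c k' * Ψ d k' := by
          simp_rw [Finset.mul_sum]
          rw [Finset.sum_comm]
          exact Finset.sum_congr rfl fun d _ => Finset.sum_congr rfl fun k' _ => by ring
  -- Step 4: each `d` contributes at most `TA + TB1 + TB2`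
  have hstep4 : ∀ d ∈ range (K + σ), WD d * ∑ k' ∈ 𝓚, c k' * Ψ d k' ≤ TA + TB1 + TB2 := by
    intro d hd
    have hdK : d < K + σ := Finset.mem_range.1 hd
    set D : ℝ := (2 : ℝ) ^ d with hD
    have hD0 : 0 < D := by positivity
    have hD1 : 1 ≤ D := one_le_pow₀ (by norm_num)
    have hDκ0 : 0 ≤ D ^ κ := Real.rpow_nonneg hD0.le κ
    by_cases hreg : Qr ≤ 16 * N * D
    · -- regime A
      have hW : WD d = A₁ := by simp only [WD, ← hD]; rw [if_pos hreg]
      have hΨ : ∀ k', Ψ d k' = XA := by intro k'; simp only [Ψ, ← hD]; rw [if_pos hreg]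
      rw [hW, Finset.sum_congr rfl fun k' _ => by rw [hΨ k'], ← Finset.sum_mul]
      calc A₁ * ((∑ k' ∈ 𝓚, c k') * XA) ≤ A₁ * (A₁ * XA) :=
            mul_le_mul_of_nonneg_left (mul_le_mul_of_nonneg_right hA₁ hXA0) hA₁0
        _ = TA := by rw [hTA]; ring
        _ ≤ TA + TB1 + TB2 := (le_add_of_nonneg_right hTB10).trans (le_add_of_nonneg_right hTB20)
    · -- regime B: `16 N D < Q`
      have h16 : 16 * N * D < Qr := lt_of_not_ge hreg
      set u : ℝ := Qr / (16 * N) with hu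
      have hu0 : 0 < u := by positivity
      have hDu : D ≤ u := by rw [hu, le_div_iff₀ (by positivity)]; linarith
      have hW : WD d = 2 * B * D ^ κ := by simp only [WD, ← hD]; rw [if_neg hreg]
      set near : ℤ → Prop := fun k' => distInt (((k' * ℓ : ℤ) : ℝ) / P) < 8 * D * N / Qr with hnear
      have hΨ : ∀ k', Ψ d k' = 2 * (2 * M + Qr * lam / D) * (if near k' then 1 else 0) +
          4 * N * geomBound (V d) (((k' * ℓ : ℤ) : ℝ) / P) := by
        intro k'; simp only [Ψ, ← hD, hnear]; rw [if_neg hreg]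
      set Wt : ℝ := ∑ k' ∈ 𝓚.filter (fun k' => near k'), c k' with hWt
      set S : ℝ := ∑ k' ∈ 𝓚, c k' * geomBound (V d) (((k' * ℓ : ℤ) : ℝ) / P) with hS
      have hWt0 : 0 ≤ Wt := Finset.sum_nonneg fun k _ => hc0 k
      have hS0 : 0 ≤ S := Finset.sum_nonneg fun k _ => mul_nonneg (hc0 k) (geomBound_nonneg (hV0 d) _)
      have hsplit : ∑ k' ∈ 𝓚, c k' * Ψ d k' = 2 * (2 * M + Qr * lam / D) * Wt + 4 * N * S := by
        rw [Finset.sum_congr rfl fun k' _ => by rw [hΨ k'], hWt, hS, Finset.sum_filter, Finset.mul_sum,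
          Finset.mul_sum, ← Finset.sum_add_distrib]
        refine Finset.sum_congr rfl fun k' _ => ?_
        split_ifs <;> ring
      rw [hW, hsplit]
      have hcoef0 : 0 ≤ 2 * (2 * M + Qr * lam / D) := by positivity
      -- the near weight: windows of length `≤ 16 D N P / Q + 1 ≤ 17 D N / R`
      have hη' : (0 : ℝ) < 8 * D * N / Qr := by positivity
      have hη'P : (8 * D * N / Qr) * P = 8 * D * N / R := by
        rw [hQPR]; field_simp
      have hDNR : 1 ≤ D * N / R := by
        rw [le_div_iff₀ hR0]
        have := mul_le_mul hD1 hNr hR0.le hD0.le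
        linarith
      have hwinlen : 2 * (8 * D * N / Qr) * P + 1 ≤ 17 * (D * N / R) := by
        have : 2 * (8 * D * N / Qr) * P = 16 * (D * N / R) := by
          rw [show 2 * (8 * D * N / Qr) * P = 2 * ((8 * D * N / Qr) * P) by ring, hη'P]; ring
        rw [this]; linarith
      have hJQ : ∀ J : ℕ, (J : ℝ) ≤ 2 * (8 * D * N / Qr) * P + 1 → J ≤ 4 * 2 ^ (K + σ) := by
        intro J hJ
        have h0 : 16 * (D * N / R) < P := by
          rw [show 16 * (D * N / R) = (16 * N * D) / R by ring, div_lt_iff₀ hR0]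
          calc 16 * N * D < Qr := h16
            _ = P * R := by rw [hQPR, mul_comm]
        have h1 : 2 * (8 * D * N / Qr) * P < P := by
          rw [show 2 * (8 * D * N / Qr) * P = 2 * ((8 * D * N / Qr) * P) by ring, hη'P,
            show 2 * (8 * D * N / R) = 16 * (D * (N : ℝ) / R) by ring]
          exact h0
        have h2 : (J : ℝ) < P + 1 := by linarith
        have h3 : (J : ℝ) < ((2 ^ σ + 1 : ℕ) : ℝ) := by push_cast; rw [hP] at h2; exact h2
        have h4 : J < 2 ^ σ + 1 := by exact_mod_cast h3
        have h5 : 2 ^ σ ≤ 2 ^ (K + σ) := Nat.pow_le_pow_right two_pos (Nat.le_add_left σ K)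
        omega
      by_cases hB1 : (D₀ : ℝ) ≤ D
      · -- regime B1: window bounds `B J^κ`
        -- near weight
        have hWtB : Wt ≤ Z₁ * (B * (17 * (D * N / R)) ^ κ) := by
          have hWnn : 0 ≤ B * (17 * (D * N / R)) ^ κ := by positivity
          have h := sum_filter_distInt_lt_le hc0 F hP0 hℓ hℓL hη' hWnn (fun a J hJ1 hJle => by
            calc ∑ k ∈ Ico a (a + J), c k ≤ B * (J : ℝ) ^ κ := hBint a J hJ1 (hJQ J hJle)
              _ ≤ B * (17 * (D * N / R)) ^ κ := by
                  refine mul_le_mul_of_nonneg_left ?_ hB0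
                  exact Real.rpow_le_rpow (Nat.cast_nonneg _) (hJle.trans hwinlen) hκ0)
          rw [hWt, hZ₁]; exact h
        -- far sum by layers
        have hN1r : (1 : ℝ) ≤ N := by exact_mod_cast Nat.one_le_two_pow.trans hN
        have hVQ : V d ≤ 2 ^ (K + σ) := by
          calc V d ≤ Qr / (16 * 2 ^ d * N) := min_le_right _ _
            _ ≤ Qr := by
                refine div_le_self hQ0.le ?_
                calc (1 : ℝ) = 1 * 1 * 1 := by ring
                  _ ≤ 16 * 2 ^ d * N := by gcongr; linarith [hD1]
            _ = 2 ^ (K + σ) := hQr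
        have hVP : V d ≤ P / 16 := by
          calc V d ≤ Qr / (16 * 2 ^ d * N) := min_le_right _ _
            _ ≤ Qr / (16 * N) := by
                refine div_le_div_of_nonneg_left hQ0.le (by positivity) ?_
                calc (16 : ℝ) * N = 16 * 1 * N := by ring
                  _ ≤ 16 * 2 ^ d * N := by gcongr
            _ = P / 16 * (R / N) := by rw [hQPR]; field_simp
            _ ≤ P / 16 * 1 := by
                refine mul_le_mul_of_nonneg_left ((div_le_one hN0).mpr hNr) (by positivity)
            _ = P / 16 := mul_one _
        have hSB : S ≤ A₁ + (K + σ) * (Z₁ * (B * (2 * P) ^ κ) * (V d) ^ (1 - κ)) := by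
          have h := sum_mul_geomBound_le_layers 𝓚 hc0 hVQ (fun k' : ℤ => ((k' * ℓ : ℤ) : ℝ) / P)
          rw [hS]
          refine h.trans (add_le_add hA₁ ?_)
          have hlayer : ∀ j ∈ (range (K + σ)).filter (fun j => (2 : ℝ) ^ j < V d),
              (2 : ℝ) ^ j * ∑ k' ∈ 𝓚.filter (fun k' => distInt (((k' * ℓ : ℤ) : ℝ) / P) < 1 / (2 * 2 ^ j)), c k'
                ≤ Z₁ * (B * (2 * P) ^ κ) * (V d) ^ (1 - κ) := by
            intro j hj
            rw [Finset.mem_filter] at hj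
            have h2j : (0 : ℝ) < 2 ^ j := by positivity
            have hjP : (2 : ℝ) ^ j ≤ P := by linarith [hj.2, hVP, hP0]
            have hηj : (0 : ℝ) < 1 / (2 * 2 ^ j) := by positivity
            have hlen : 2 * (1 / (2 * 2 ^ j)) * P + 1 ≤ 2 * P / 2 ^ j := by
              rw [show 2 * (1 / (2 * (2 : ℝ) ^ j)) * P = P / 2 ^ j by field_simp]
              rw [show 2 * P / (2 : ℝ) ^ j = P / 2 ^ j + P / 2 ^ j by ring]
              have : 1 ≤ P / 2 ^ j := by rw [le_div_iff₀ h2j]; linarith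
              linarith
            have hWnn : 0 ≤ B * (2 * P / 2 ^ j) ^ κ := by positivity
            have hcov := sum_filter_distInt_lt_le hc0 F hP0 hℓ hℓL hηj hWnn (fun a J hJ1 hJle => by
              have hJ4 : J ≤ 4 * 2 ^ (K + σ) := by
                have h1 : (J : ℝ) ≤ 2 * P := by
                  have : 2 * P / (2 : ℝ) ^ j ≤ 2 * P := div_le_self (by positivity) (one_le_pow₀ (by norm_num))
                  linarith
                have h2 : (J : ℝ) ≤ ((2 * 2 ^ σ : ℕ) : ℝ) := by push_cast; rw [hP] at h1; exact h1
                have h3 : J ≤ 2 * 2 ^ σ := by exact_mod_cast h2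
                have h5 : 2 ^ σ ≤ 2 ^ (K + σ) := Nat.pow_le_pow_right two_pos (Nat.le_add_left σ K)
                omega
              calc ∑ k ∈ Ico a (a + J), c k ≤ B * (J : ℝ) ^ κ := hBint a J hJ1 hJ4
                _ ≤ B * (2 * P / 2 ^ j) ^ κ := by
                    refine mul_le_mul_of_nonneg_left ?_ hB0
                    exact Real.rpow_le_rpow (Nat.cast_nonneg _) (hJle.trans hlen) hκ0)
            rw [← hZ₁] at hcov
            calc (2 : ℝ) ^ j * ∑ k' ∈ 𝓚.filter (fun k' => distInt (((k' * ℓ : ℤ) : ℝ) / P) < 1 / (2 * 2 ^ j)), c k'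
                ≤ (2 : ℝ) ^ j * (Z₁ * (B * (2 * P / 2 ^ j) ^ κ)) := mul_le_mul_of_nonneg_left hcov h2j.le
              _ = Z₁ * (B * (2 * P) ^ κ) * ((2 : ℝ) ^ j * ((2 : ℝ) ^ j) ^ (-κ)) := by
                  rw [Real.div_rpow (by positivity) h2j.le, Real.rpow_neg h2j.le]; ring
              _ = Z₁ * (B * (2 * P) ^ κ) * ((2 : ℝ) ^ j) ^ (1 - κ) := by
                  rw [Real.rpow_sub h2j, Real.rpow_one, Real.rpow_neg h2j.le, div_eq_mul_inv]
              _ ≤ Z₁ * (B * (2 * P) ^ κ) * (V d) ^ (1 - κ) := by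
                  refine mul_le_mul_of_nonneg_left ?_ (by positivity)
                  exact Real.rpow_le_rpow h2j.le hj.2.le (by linarith)
          calc ∑ j ∈ (range (K + σ)).filter (fun j => (2 : ℝ) ^ j < V d),
                (2 : ℝ) ^ j * ∑ k' ∈ 𝓚.filter (fun k' => distInt (((k' * ℓ : ℤ) : ℝ) / P) < 1 / (2 * 2 ^ j)), c k'
              ≤ ∑ _j ∈ (range (K + σ)).filter (fun j => (2 : ℝ) ^ j < V d),
                  Z₁ * (B * (2 * P) ^ κ) * (V d) ^ (1 - κ) := Finset.sum_le_sum hlayer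
            _ = ((range (K + σ)).filter (fun j => (2 : ℝ) ^ j < V d)).card *
                  (Z₁ * (B * (2 * P) ^ κ) * (V d) ^ (1 - κ)) := by rw [Finset.sum_const, nsmul_eq_mul]
            _ ≤ (K + σ) * (Z₁ * (B * (2 * P) ^ κ) * (V d) ^ (1 - κ)) := by
                refine mul_le_mul_of_nonneg_right ?_ (by positivity)
                have := (Finset.card_filter_le (range (K + σ)) (fun j => (2 : ℝ) ^ j < V d))
                rw [Finset.card_range] at this
                exact_mod_cast this
        -- rpow bookkeeping
        have hρ0 : 0 < (N : ℝ) / R := by positivity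
        have h17 : (17 : ℝ) ^ κ ≤ 17 := by
          have := Real.rpow_le_rpow_of_exponent_le (by norm_num : (1 : ℝ) ≤ 17) (show κ ≤ 1 by linarith)
          rwa [Real.rpow_one] at this
        have h2κ : (2 : ℝ) ^ κ ≤ 2 := by
          have := Real.rpow_le_rpow_of_exponent_le (by norm_num : (1 : ℝ) ≤ 2) (show κ ≤ 1 by linarith)
          rwa [Real.rpow_one] at this
        have hsplit17 : (17 * (D * N / R)) ^ κ = 17 ^ κ * D ^ κ * ((N : ℝ) / R) ^ κ := by
          rw [Real.mul_rpow (by norm_num) (by positivity), show D * N / R = D * ((N : ℝ) / R) by ring,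
            Real.mul_rpow hD0.le hρ0.le]; ring
        have hsplit2P : (2 * P) ^ κ = 2 ^ κ * P ^ κ := Real.mul_rpow (by norm_num) hP0.le
        have hDD : D ^ κ * D ^ κ = D ^ (2 * κ) := by rw [← Real.rpow_add hD0]; ring_nf
        have hDDinv : D ^ κ * D ^ κ / D = D ^ (2 * κ - 1) := by
          rw [hDD, Real.rpow_sub hD0, Real.rpow_one]
        have hD2κ : D ^ (2 * κ) ≤ u ^ (2 * κ) := Real.rpow_le_rpow hD0.le hDu (by linarith)
        have hDκu : D ^ κ ≤ u ^ κ := Real.rpow_le_rpow hD0.le hDu hκ0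
        have hD2κ1 : D ^ (2 * κ - 1) ≤ (D₀ : ℝ) ^ (2 * κ - 1) :=
          Real.rpow_le_rpow_of_nonpos (by positivity) hB1 (by linarith)
        have hVu : (V d) ^ (1 - κ) ≤ (u / D) ^ (1 - κ) := by
          refine Real.rpow_le_rpow (hV0 d) ?_ (by linarith)
          calc V d ≤ Qr / (16 * 2 ^ d * N) := min_le_right _ _
            _ = u / D := by rw [hu, hD]; field_simp
        have hmix : D ^ κ * (u / D) ^ (1 - κ) = u ^ (1 - κ) * D ^ (2 * κ - 1) := by
          rw [Real.div_rpow hu0.le hD0.le, div_eq_mul_inv, ← Real.rpow_neg hD0.le,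
            show (2 : ℝ) * κ - 1 = κ + -(1 - κ) by ring, Real.rpow_add hD0]
          ring
        -- the four pieces
        have hpiece1 : 2 * B * D ^ κ * (2 * (2 * M) * (Z₁ * (B * (17 * (D * N / R)) ^ κ))) ≤
            136 * B ^ 2 * Z₁ * M * u ^ (2 * κ) * ((N : ℝ) / R) ^ κ := by
          rw [hsplit17]
          calc 2 * B * D ^ κ * (2 * (2 * M) * (Z₁ * (B * (17 ^ κ * D ^ κ * ((N : ℝ) / R) ^ κ))))
              = 8 * B ^ 2 * Z₁ * M * 17 ^ κ * (D ^ κ * D ^ κ) * ((N : ℝ) / R) ^ κ := by ring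
            _ ≤ 8 * B ^ 2 * Z₁ * M * 17 * u ^ (2 * κ) * ((N : ℝ) / R) ^ κ := by
                rw [hDD]; gcongr
            _ = _ := by ring
        have hpiece2 : 2 * B * D ^ κ * (2 * (Qr * lam / D) * (Z₁ * (B * (17 * (D * N / R)) ^ κ))) ≤
            68 * B ^ 2 * Z₁ * Qr * lam * (D₀ : ℝ) ^ (2 * κ - 1) * ((N : ℝ) / R) ^ κ := by
          rw [hsplit17]
          calc 2 * B * D ^ κ * (2 * (Qr * lam / D) * (Z₁ * (B * (17 ^ κ * D ^ κ * ((N : ℝ) / R) ^ κ))))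
              = 4 * B ^ 2 * Z₁ * Qr * lam * 17 ^ κ * (D ^ κ * D ^ κ / D) * ((N : ℝ) / R) ^ κ := by
                ring
            _ ≤ 4 * B ^ 2 * Z₁ * Qr * lam * 17 * (D₀ : ℝ) ^ (2 * κ - 1) * ((N : ℝ) / R) ^ κ := by
                rw [hDDinv]; gcongr
            _ = _ := by ring
        have hpiece3 : 2 * B * D ^ κ * (4 * N * A₁) ≤ 8 * B * N * A₁ * u ^ κ := by
          calc 2 * B * D ^ κ * (4 * N * A₁) = 8 * B * N * A₁ * D ^ κ := by ring
            _ ≤ 8 * B * N * A₁ * u ^ κ := by gcongr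
        have hpiece4 : 2 * B * D ^ κ * (4 * N * ((K + σ) * (Z₁ * (B * (2 * P) ^ κ) * (V d) ^ (1 - κ)))) ≤
            16 * B ^ 2 * N * (K + σ) * Z₁ * P ^ κ * u ^ (1 - κ) * (D₀ : ℝ) ^ (2 * κ - 1) := by
          rw [hsplit2P]
          calc 2 * B * D ^ κ * (4 * N * ((K + σ) * (Z₁ * (B * (2 ^ κ * P ^ κ)) * (V d) ^ (1 - κ))))
              = 8 * B ^ 2 * N * (K + σ) * Z₁ * P ^ κ * 2 ^ κ * (D ^ κ * (V d) ^ (1 - κ)) := by ring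
            _ ≤ 8 * B ^ 2 * N * (K + σ) * Z₁ * P ^ κ * 2 * (D ^ κ * (u / D) ^ (1 - κ)) := by
                gcongr
            _ = 16 * B ^ 2 * N * (K + σ) * Z₁ * P ^ κ * (u ^ (1 - κ) * D ^ (2 * κ - 1)) := by
                rw [hmix]; ring
            _ ≤ 16 * B ^ 2 * N * (K + σ) * Z₁ * P ^ κ * (u ^ (1 - κ) * (D₀ : ℝ) ^ (2 * κ - 1)) := by
                gcongr
            _ = _ := by ring
        calc 2 * B * D ^ κ * (2 * (2 * M + Qr * lam / D) * Wt + 4 * N * S)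
            ≤ 2 * B * D ^ κ * (2 * (2 * M + Qr * lam / D) * (Z₁ * (B * (17 * (D * N / R)) ^ κ)) +
                4 * N * (A₁ + (K + σ) * (Z₁ * (B * (2 * P) ^ κ) * (V d) ^ (1 - κ)))) := by
              gcongr
          _ = 2 * B * D ^ κ * (2 * (2 * M) * (Z₁ * (B * (17 * (D * N / R)) ^ κ))) +
              2 * B * D ^ κ * (2 * (Qr * lam / D) * (Z₁ * (B * (17 * (D * N / R)) ^ κ))) +
              2 * B * D ^ κ * (4 * N * A₁) +
              2 * B * D ^ κ * (4 * N * ((K + σ) * (Z₁ * (B * (2 * P) ^ κ) * (V d) ^ (1 - κ)))) := by ring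
          _ ≤ TB1 := by rw [hTB1]; exact add_le_add (add_le_add (add_le_add hpiece1 hpiece2) hpiece3) hpiece4
          _ ≤ TA + TB1 + TB2 := (le_add_of_nonneg_left hTA0).trans (le_add_of_nonneg_right hTB20)
      · -- regime B2: `D < D₀`, sup bounds
        have hDD₀ : D ≤ D₀ := (lt_of_not_ge hB1).le
        have hWtB : Wt ≤ Z₁ * (Ainf * (17 * (D * N / R))) := by
          have hWnn : 0 ≤ Ainf * (17 * (D * N / R)) := by positivity
          have h := sum_filter_distInt_lt_le hc0 F hP0 hℓ hℓL hη' hWnn (fun a J _ hJle => by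
            calc ∑ k ∈ Ico a (a + J), c k ≤ ∑ _k ∈ Ico a (a + J), Ainf := (Finset.sum_le_sum fun k _ => hAinf k)
              _ = (J : ℝ) * Ainf := by
                  rw [Finset.sum_const, nsmul_eq_mul, Int.card_Ico, show (a + (J : ℤ) - a).toNat = J by simp]
              _ ≤ (17 * (D * N / R)) * Ainf := mul_le_mul_of_nonneg_right (hJle.trans hwinlen) hA0
              _ = Ainf * (17 * (D * N / R)) := mul_comm _ _)
          rw [hWt, hZ₁]; exact h
        have hSB : S ≤ Ainf * Z₂ * (2 * L * M + P * lam) := by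
          have h := sum_Ioo_mul_geomBound_le_sup hA0 hAinf F σ (hV0 d) hℓ
          rw [hS]
          refine h.trans ?_
          rw [← hP, ← hZ₂]
          refine mul_le_mul_of_nonneg_left ?_ (mul_nonneg hA0 hZ₂0)
          have hLv : (2 : ℝ) ^ (ℓ.natAbs.factorization 2 + 1) ≤ 2 * L := by
            have h1 : 2 ^ ℓ.natAbs.factorization 2 ≤ ℓ.natAbs := Nat.ordProj_le 2 (Int.natAbs_ne_zero.mpr hℓ)
            have h2 : ((2 ^ ℓ.natAbs.factorization 2 : ℕ) : ℝ) ≤ (ℓ.natAbs : ℝ) := by exact_mod_cast h1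
            push_cast at h2
            rw [pow_succ]; linarith
          have hVM : V d ≤ M := min_le_left _ _
          have hlogP : 1 + Real.log P ≤ lam := by
            rw [hlam, hP, hQr]
            have : Real.log ((2 : ℝ) ^ σ) ≤ Real.log ((2 : ℝ) ^ (K + σ)) :=
              Real.log_le_log (by positivity) (pow_le_pow_right₀ (by norm_num) (Nat.le_add_left σ K))
            linarith
          have hlogP0 : 0 ≤ 1 + Real.log P := by
            have : 0 ≤ Real.log P := Real.log_nonneg (by rw [hP]; exact one_le_pow₀ (by norm_num)); linarith
          exact add_le_add (mul_le_mul hLv hVM (hV0 d) (by positivity)) (mul_le_mul_of_nonneg_left hlogP hP0.le)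
        have hDκ : D ^ κ ≤ (D₀ : ℝ) ^ κ := Real.rpow_le_rpow hD0.le hDD₀ hκ0
        have hD1κ : D ^ κ * D ≤ (D₀ : ℝ) ^ (1 + κ) := by
          rw [show D ^ κ * D = D ^ (1 + κ) by rw [Real.rpow_add hD0, Real.rpow_one]; ring]
          exact Real.rpow_le_rpow hD0.le hDD₀ (by linarith)
        have hpiece5 : 2 * B * D ^ κ * (2 * (2 * M) * (Z₁ * (Ainf * (17 * (D * N / R))))) ≤
            144 * B * Z₁ * Ainf * M * (D₀ : ℝ) ^ (1 + κ) * N / R := by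
          calc 2 * B * D ^ κ * (2 * (2 * M) * (Z₁ * (Ainf * (17 * (D * N / R)))))
              = 136 * B * Z₁ * Ainf * M * (D ^ κ * D) * N / R := by ring
            _ ≤ 144 * B * Z₁ * Ainf * M * (D ^ κ * D) * N / R := by gcongr; norm_num
            _ ≤ 144 * B * Z₁ * Ainf * M * (D₀ : ℝ) ^ (1 + κ) * N / R := by gcongr
        have hpiece6 : 2 * B * D ^ κ * (2 * (Qr * lam / D) * (Z₁ * (Ainf * (17 * (D * N / R))))) ≤
            72 * B * Z₁ * Ainf * lam * (D₀ : ℝ) ^ κ * Qr * N / R := by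
          have hDinv : D⁻¹ * D = 1 := inv_mul_cancel₀ hD0.ne'
          calc 2 * B * D ^ κ * (2 * (Qr * lam / D) * (Z₁ * (Ainf * (17 * (D * N / R)))))
              = 68 * B * Z₁ * Ainf * lam * D ^ κ * Qr * N / R * (D⁻¹ * D) := by
                rw [div_eq_mul_inv (Qr * lam) D]; ring
            _ = 68 * B * Z₁ * Ainf * lam * D ^ κ * Qr * N / R := by rw [hDinv, mul_one]
            _ ≤ 72 * B * Z₁ * Ainf * lam * D ^ κ * Qr * N / R := by gcongr; norm_num
            _ ≤ 72 * B * Z₁ * Ainf * lam * (D₀ : ℝ) ^ κ * Qr * N / R := by gcongr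
        have hXnn : 0 ≤ 2 * L * M + P * lam :=
          add_nonneg (mul_nonneg (mul_nonneg (by norm_num) hL0) hM) (mul_nonneg hP0.le (by linarith))
        have hC7 : 0 ≤ 8 * B * N * Ainf * Z₂ * (2 * L * M + P * lam) :=
          mul_nonneg (mul_nonneg (mul_nonneg (mul_nonneg (mul_nonneg (by norm_num) hB0) hN0.le) hA0) hZ₂0) hXnn
        have hpiece7 : 2 * B * D ^ κ * (4 * N * (Ainf * Z₂ * (2 * L * M + P * lam))) ≤
            8 * B * (D₀ : ℝ) ^ κ * N * Ainf * Z₂ * (2 * L * M + P * lam) := by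
          have h1 : 2 * B * D ^ κ * (4 * N * (Ainf * Z₂ * (2 * L * M + P * lam))) =
              (8 * B * N * Ainf * Z₂ * (2 * L * M + P * lam)) * D ^ κ := by ring
          have h2 : 8 * B * (D₀ : ℝ) ^ κ * N * Ainf * Z₂ * (2 * L * M + P * lam) =
              (8 * B * N * Ainf * Z₂ * (2 * L * M + P * lam)) * (D₀ : ℝ) ^ κ := by ring
          rw [h1, h2]
          exact mul_le_mul_of_nonneg_left hDκ hC7
        have hWt1 : 2 * (2 * M + Qr * lam / D) * Wt ≤ 2 * (2 * M + Qr * lam / D) * (Z₁ * (Ainf * (17 * (D * N / R)))) :=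
          mul_le_mul_of_nonneg_left hWtB hcoef0
        have hS1 : 4 * N * S ≤ 4 * N * (Ainf * Z₂ * (2 * L * M + P * lam)) :=
          mul_le_mul_of_nonneg_left hSB (by positivity)
        have hexp : 2 * B * D ^ κ * (2 * (2 * M + Qr * lam / D) * (Z₁ * (Ainf * (17 * (D * N / R)))) +
            4 * N * (Ainf * Z₂ * (2 * L * M + P * lam))) =
            2 * B * D ^ κ * (2 * (2 * M) * (Z₁ * (Ainf * (17 * (D * N / R))))) +
              2 * B * D ^ κ * (2 * (Qr * lam / D) * (Z₁ * (Ainf * (17 * (D * N / R))))) +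
              2 * B * D ^ κ * (4 * N * (Ainf * Z₂ * (2 * L * M + P * lam))) := by ring
        have hmono : 2 * B * D ^ κ * (2 * (2 * M + Qr * lam / D) * Wt + 4 * N * S) ≤
            2 * B * D ^ κ * (2 * (2 * M + Qr * lam / D) * (Z₁ * (Ainf * (17 * (D * N / R)))) +
              4 * N * (Ainf * Z₂ * (2 * L * M + P * lam))) :=
          mul_le_mul_of_nonneg_left (add_le_add hWt1 hS1) (mul_nonneg (mul_nonneg (by norm_num) hB0) hDκ0)
        rw [hexp] at hmono
        have hsum : 2 * B * D ^ κ * (2 * (2 * M + Qr * lam / D) * Wt + 4 * N * S) ≤ TB2 := by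
          rw [hTB2]; exact hmono.trans (add_le_add (add_le_add hpiece5 hpiece6) hpiece7)
        exact hsum.trans (le_add_of_nonneg_left (add_nonneg hTA0 hTB10))
  calc _ ≤ ∑ d ∈ range (K + σ), WD d * ∑ k' ∈ 𝓚, c k' * Ψ d k' := hstep3
    _ ≤ ∑ _d ∈ range (K + σ), (TA + TB1 + TB2) := Finset.sum_le_sum hstep4
    _ = ((K + σ : ℕ) : ℝ) * (TA + TB1 + TB2) := by
        rw [Finset.sum_const, Finset.card_range, nsmul_eq_mul]

end Literature.NumberTheory.LFunctions.MoebiusWalsh
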